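import Literature.Computability.Complexity.Williams2014SatInstanceCode
import Literature.Computability.Complexity.Williams2014MachineB
import Literature.Computability.Complexity.Williams2014MachineBPlumbing
import Literature.Computability.Complexity.CodeFPArith
import Literature.Computability.Complexity.DiagMachine
import HarnessLib

/-!
# Williams' Theorem 3.2, the machine `B`: stage `F` is polynomial time

Companion of `Williams2014SatInstanceCode.lean` (the code `circuitC` of the witness-check circuit
`WitnessCheck.circuit G W` computed on the codes of the clause circuits and of `W`, the validity
test `validC` and the parser `deserialize` of a guessed witness code) and of
`Williams2014MachineB.lean` (the machine `B` of R. Williams, *Nonuniform ACC circuit lower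
bounds*, J. ACM 61 (2014), proof of Thm. 3.2, assembled from its stages; stage `F` is the
specification `SatInstanceFn.Spec`). This file proves that stage `F` is realised by a
polynomial-time string function: **`exists_satInstanceFn : ∀ m dW e, ∃ F, F ∈ FP ∧
SatInstanceFn.Spec m dW e F`**, and therewith DISCHARGES the named fact
**`Williams2014_thm_3_2_machineB`** (`Williams2014Lemma31.lean`):
`Williams2014_thm_3_2_machineB_holds`, from the assembly theorem of `Williams2014MachineB.lean`,
the linear-time stages of `Williams2014MachineBPlumbing.lean` and `exists_satInstanceFn`; so that
Williams' Thm. 3.2 and the `ACC` lower-bound transfer (Thm. 1.3) now rest on Fact 3.1, IKW's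
Thm. 5.2 and Lemma 3.1 only (`Williams2014_thm_3_2_of_lemma_3_1`,
`Williams2014_lowerBound_of_accSat_of_three`, the time hierarchy being `Diag.ntime_hierarchy_holds`).

The proof is written in the typed calculus `CodeFP` of `CodeFP.lean` / `CodeFPArith.lean`
(a map between encoded types "is computed on codes by an `FP` string function", closed under
composition, pairing, branching, numeral arithmetic, and maps / bounded folds over coded lists):
every code-level function of `Williams2014SatInstanceCode.lean` is an ordinary functional program,
and its `CodeFP` fact is assembled from the combinators, the only hand-made estimates being the
polynomial bounds of the accumulators of its five folds (prefix sums of block sizes, the flat-code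
parser, pairing of wire fields, the position counter of `gatesOK`, the depth table `depthsC`).
Three short string-level facts close the gap to the untyped specification: the total decoder of a
guessed string into a list of naturals (`decStr`, read by `Brick.foldFn`, whose semantics holds on
EVERY string), the dispatch on the leading flag bit, and the shaping of the output word.

## References

* R. Williams, *Nonuniform ACC circuit lower bounds*, J. ACM 61(1) (2014) 2:1–2:32, proof of
  Thm. 3.2 (p. 13) [Williams2014].
* S. Arora, B. Barak, *Computational Complexity: A Modern Approach*, CUP 2009, §1.3 (polynomial
  time: composition and bounded loops), §0.1 (codes of tuples and lists) [AroraBarak2009].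
-/

namespace Literature.Computability.Complexity

namespace SatCode

open _root_.Computability CodeFP Polynomial

/-! ### Codes of wires, gates, blocks -/

/-- The code of a wire code `(t, i)`: the pair of the binary numerals. [folklore] -/
abbrev wireE : WireC → List Bool := pairE natE natE

/-- The code of a gate code: symbolic code and the raw list of its wires. [folklore] -/
abbrev gateE : GateC → List Bool := pairE natE (rawE wireE)

/-- The code of a block (output wire and gates of one clause circuit). [folklore] -/
abbrev blockE : WireC × List GateC → List Bool := pairE wireE (rawE gateE)

/-- `wireE` is injective. [folklore] -/
theorem wireE_injective : Function.Injective wireE := pairE_injective natE_injective natE_injective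

/-- `gateE` is injective. [folklore] -/
theorem gateE_injective : Function.Injective gateE :=
  pairE_injective natE_injective (rawE_injective wireE_injective)

/-! ### Relocation, plugging and the gate appenders are computed on codes

Elaboration discipline (the unifier does not solve the higher-order constraints that an expected
`CodeFP … (fun p => …)` puts on a composite of combinators): composites are built bottom-up with
`have h := …` from leaves whose codes are pinned, and matched to the stated map by `h.congr`. -/

section Leaves

variable {α β γ : Type} (eα : α → List Bool) (eβ : β → List Bool) (eγ : γ → List Bool)

/-- A constant with both codes pinned. [folklore] -/
theorem cst (b : β) : CodeFP eα eβ (fun _ => b) := const eα b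
/-- Projection `t.2.1` of a triple code. [folklore] -/
theorem p21 : CodeFP (pairE eα (pairE eβ eγ)) eβ (fun t => t.2.1) := (snd eα (pairE eβ eγ)).fst'
/-- Projection `t.2.2` of a triple code. [folklore] -/
theorem p22 : CodeFP (pairE eα (pairE eβ eγ)) eγ (fun t => t.2.2) := (snd eα (pairE eβ eγ)).snd'
/-- Projection `t.1.1` of a triple code. [folklore] -/
theorem p11 : CodeFP (pairE (pairE eα eβ) eγ) eα (fun t => t.1.1) := (fst (pairE eα eβ) eγ).fst'
/-- Projection `t.1.2` of a triple code. [folklore] -/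
theorem p12 : CodeFP (pairE (pairE eα eβ) eγ) eβ (fun t => t.1.2) := (fst (pairE eα eβ) eγ).snd'

end Leaves

/-- `shiftC` on codes. [folklore] -/
theorem shiftC_code : CodeFP (pairE natE wireE) wireE (fun p => shiftC p.1 p.2) := by
  have hL : CodeFP (pairE natE wireE) natE (fun p => p.1) := fst natE wireE
  have ht : CodeFP (pairE natE wireE) natE (fun p => p.2.1) := p21 natE natE natE
  have hi : CodeFP (pairE natE wireE) natE (fun p => p.2.2) := p22 natE natE natE
  have hw : CodeFP (pairE natE wireE) wireE (fun p => p.2) := snd natE wireE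
  have hc := natEq.comp (ht.pair (cst (pairE natE wireE) natE (0 : ℕ)))
  have he := ht.pair (natAdd.comp (hi.pair hL))
  have h := hc.ite hw he
  exact h.congr fun p => by
    by_cases h0 : p.2.1 = 0 <;> simp [shiftC, h0]

/-- `shiftGateC` on codes. [folklore] -/
theorem shiftGateC_code : CodeFP (pairE natE gateE) gateE (fun p => shiftGateC p.1 p.2) := by
  have hL : CodeFP (pairE natE gateE) natE (fun p => p.1) := fst natE gateE
  have hc : CodeFP (pairE natE gateE) natE (fun p => p.2.1) := p21 natE natE (rawE wireE)
  have hws : CodeFP (pairE natE gateE) (rawE wireE) (fun p => p.2.2) := p22 natE natE (rawE wireE)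
  have h := hc.pair ((map shiftC_code).comp (hL.pair hws))
  exact h.congr fun _ => rfl

/-- `substW` on codes (input table, shift, wire). [folklore] -/
theorem substW_code : CodeFP (pairE (pairE (rawE wireE) natE) wireE) wireE (fun p => substW p.1.1 p.1.2 p.2) := by
  have hT : CodeFP (pairE (pairE (rawE wireE) natE) wireE) (rawE wireE) (fun p => p.1.1) := p11 (rawE wireE) natE wireE
  have hL : CodeFP (pairE (pairE (rawE wireE) natE) wireE) natE (fun p => p.1.2) := p12 (rawE wireE) natE wireE
  have ht : CodeFP (pairE (pairE (rawE wireE) natE) wireE) natE (fun p => p.2.1) := p21 (pairE (rawE wireE) natE) natE natE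
  have hi : CodeFP (pairE (pairE (rawE wireE) natE) wireE) natE (fun p => p.2.2) := p22 (pairE (rawE wireE) natE) natE natE
  have hc := natEq.comp (ht.pair (cst (pairE (pairE (rawE wireE) natE) wireE) natE (0 : ℕ)))
  have hget := (rawGetOr wireE).comp (hT.pair (hi.pair (cst (pairE (pairE (rawE wireE) natE) wireE) wireE ((0 : ℕ), (0 : ℕ)))))
  have he := ht.pair (natAdd.comp (hi.pair hL))
  have h := hc.ite hget he
  exact h.congr fun p => by
    by_cases h0 : p.2.1 = 0 <;> simp [substW, h0]

/-- `relocC` on codes. [folklore] -/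
theorem relocC_code : CodeFP (pairE (pairE (rawE wireE) natE) gateE) gateE (fun p => relocC p.1.1 p.1.2 p.2) := by
  have hctx : CodeFP (pairE (pairE (rawE wireE) natE) gateE) (pairE (rawE wireE) natE) (fun p => p.1) :=
    fst (pairE (rawE wireE) natE) gateE
  have hc : CodeFP (pairE (pairE (rawE wireE) natE) gateE) natE (fun p => p.2.1) := p21 (pairE (rawE wireE) natE) natE (rawE wireE)
  have hws : CodeFP (pairE (pairE (rawE wireE) natE) gateE) (rawE wireE) (fun p => p.2.2) := p22 (pairE (rawE wireE) natE) natE (rawE wireE)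
  have h := hc.pair ((map substW_code).comp (hctx.pair hws))
  exact h.congr fun _ => rfl

/-- The code of the arguments of `plugC`. [folklore] -/
abbrev plugInE : List GateC × List WireC × List GateC × WireC → List Bool :=
  pairE (rawE gateE) (pairE (rawE wireE) (pairE (rawE gateE) wireE))

/-- `plugC` on codes: `(gs, T, ags, aout) ↦ plugC gs T ags aout`. [folklore] -/
theorem plugC_code : CodeFP plugInE (pairE (rawE gateE) wireE) (fun p => plugC p.1 p.2.1 p.2.2.1 p.2.2.2) := by
  have hgs : CodeFP plugInE (rawE gateE) (fun p => p.1) := fst (rawE gateE) _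
  have hT : CodeFP plugInE (rawE wireE) (fun p => p.2.1) := p21 (rawE gateE) (rawE wireE) _
  have hags : CodeFP plugInE (rawE gateE) (fun p => p.2.2.1) := (p22 (rawE gateE) (rawE wireE) (pairE (rawE gateE) wireE)).fst'
  have hout : CodeFP plugInE wireE (fun p => p.2.2.2) := (p22 (rawE gateE) (rawE wireE) (pairE (rawE gateE) wireE)).snd'
  have hctx := hT.pair ((natLength gateE).comp hgs)
  have hmap := (map relocC_code).comp (hctx.pair hags)
  have ho := substW_code.comp (hctx.pair hout)
  have h := ((rawAppend gateE).comp (hgs.pair hmap)).pair ho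
  exact h.congr fun _ => rfl

/-- `andC`/`orC` on codes (symbolic code `c`). [folklore] -/
theorem binC_code (c : ℕ) : CodeFP (pairE (rawE gateE) (pairE wireE wireE)) (pairE (rawE gateE) wireE)
    (fun p => (p.1 ++ [(c, [p.2.1, p.2.2])], ((1 : ℕ), p.1.length))) := by
  have hgs : CodeFP (pairE (rawE gateE) (pairE wireE wireE)) (rawE gateE) (fun p => p.1) := fst (rawE gateE) _
  have hu : CodeFP (pairE (rawE gateE) (pairE wireE wireE)) wireE (fun p => p.2.1) := p21 (rawE gateE) wireE wireE
  have hv : CodeFP (pairE (rawE gateE) (pairE wireE wireE)) wireE (fun p => p.2.2) := p22 (rawE gateE) wireE wireE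
  have hg := (cst (pairE (rawE gateE) (pairE wireE wireE)) natE c).pair
    ((rawCons wireE).comp (hu.pair ((rawSingleton wireE).comp hv)))
  have h := ((rawAppend gateE).comp (hgs.pair ((rawSingleton gateE).comp hg))).pair
    ((cst (pairE (rawE gateE) (pairE wireE wireE)) natE (1 : ℕ)).pair ((natLength gateE).comp hgs))
  exact h.congr fun _ => rfl

/-- `andC` on codes. [folklore] -/
theorem andC_code : CodeFP (pairE (rawE gateE) (pairE wireE wireE)) (pairE (rawE gateE) wireE)
    (fun p => andC p.1 p.2.1 p.2.2) := (binC_code 1).congr fun _ => rfl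

/-- `orC` on codes. [folklore] -/
theorem orC_code : CodeFP (pairE (rawE gateE) (pairE wireE wireE)) (pairE (rawE gateE) wireE)
    (fun p => orC p.1 p.2.1 p.2.2) := (binC_code 2).congr fun _ => rfl

/-- `notC` on codes. [folklore] -/
theorem notC_code : CodeFP (pairE (rawE gateE) wireE) (pairE (rawE gateE) wireE) (fun p => notC p.1 p.2) := by
  have hgs : CodeFP (pairE (rawE gateE) wireE) (rawE gateE) (fun p => p.1) := fst (rawE gateE) wireE
  have hu : CodeFP (pairE (rawE gateE) wireE) wireE (fun p => p.2) := snd (rawE gateE) wireE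
  have hg := (cst (pairE (rawE gateE) wireE) natE (0 : ℕ)).pair ((rawSingleton wireE).comp hu)
  have h := ((rawAppend gateE).comp (hgs.pair ((rawSingleton gateE).comp hg))).pair
    ((cst (pairE (rawE gateE) wireE) natE (1 : ℕ)).pair ((natLength gateE).comp hgs))
  exact h.congr fun _ => rfl

/-- The code of the arguments of `or₃C` / `addSlotC`: a program and three wires. [folklore] -/
abbrev gadgetInE : List GateC × WireC × WireC × WireC → List Bool :=
  pairE (rawE gateE) (pairE wireE (pairE wireE wireE))

/-- `or₃C` on codes. [folklore] -/
theorem or₃C_code : CodeFP gadgetInE (pairE (rawE gateE) wireE) (fun p => or₃C p.1 p.2.1 p.2.2.1 p.2.2.2) := by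
  have hgs : CodeFP gadgetInE (rawE gateE) (fun p => p.1) := fst (rawE gateE) _
  have hu : CodeFP gadgetInE wireE (fun p => p.2.1) := p21 (rawE gateE) wireE (pairE wireE wireE)
  have hv : CodeFP gadgetInE wireE (fun p => p.2.2.1) := (p22 (rawE gateE) wireE (pairE wireE wireE)).fst'
  have hw : CodeFP gadgetInE wireE (fun p => p.2.2.2) := (p22 (rawE gateE) wireE (pairE wireE wireE)).snd'
  have hg := (cst gadgetInE natE (2 : ℕ)).pair ((rawCons wireE).comp (hu.pair ((rawCons wireE).comp
    (hv.pair ((rawSingleton wireE).comp hw)))))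
  have h := ((rawAppend gateE).comp (hgs.pair ((rawSingleton gateE).comp hg))).pair
    ((cst gadgetInE natE (1 : ℕ)).pair ((natLength gateE).comp hgs))
  exact h.congr fun _ => rfl

/-- `addSlotC` on codes: `(gs, a, s, p) ↦ addSlotC gs a s p`. [folklore] -/
theorem addSlotC_code : CodeFP gadgetInE (pairE (rawE gateE) wireE) (fun p => addSlotC p.1 p.2.1 p.2.2.1 p.2.2.2) := by
  have hgs : CodeFP gadgetInE (rawE gateE) (fun p => p.1) := fst (rawE gateE) _
  have ha : CodeFP gadgetInE wireE (fun p => p.2.1) := p21 (rawE gateE) wireE (pairE wireE wireE)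
  have hs : CodeFP gadgetInE wireE (fun p => p.2.2.1) := (p22 (rawE gateE) wireE (pairE wireE wireE)).fst'
  have hp : CodeFP gadgetInE wireE (fun p => p.2.2.2) := (p22 (rawE gateE) wireE (pairE wireE wireE)).snd'
  have h1 := andC_code.comp (hgs.pair (ha.pair hs))
  have h2 := notC_code.comp (h1.fst'.pair ha)
  have h3 := notC_code.comp (h2.fst'.pair hs)
  have h4 := andC_code.comp (h3.fst'.pair (h2.snd'.pair h3.snd'))
  have h5 := orC_code.comp (h4.fst'.pair (h1.snd'.pair h4.snd'))
  have h6 := andC_code.comp (h5.fst'.pair (hp.pair h5.snd'))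
  exact h6.congr fun _ => rfl

/-! ### Canonical codes, validity tests -/

/-- `orCode` on codes. [folklore] -/
theorem orCode_code : CodeFP natE natE orCode := by
  have h := (natEq.comp ((CodeFP.id natE).pair (cst natE natE (1 : ℕ)))).ite (cst natE natE (1 : ℕ)) (cst natE natE (2 : ℕ))
  exact h.congr fun k => by
    by_cases hk : k = 1 <;> simp [orCode, hk]

/-- `modCode m` on codes (the modulus is a constant of the program). [folklore] -/
theorem modCode_code (m : ℕ) : CodeFP natE natE (modCode m) := by
  have hc1 := (natEq.comp ((CodeFP.id natE).pair (cst natE natE (1 : ℕ)))).and (cst natE bitE (decide (m ≠ 1)))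
  have hc2 := (cst natE bitE (decide (m = 0))).or (natLt.comp ((CodeFP.id natE).pair (cst natE natE m)))
  have h := hc1.ite (cst natE natE (1 : ℕ)) (hc2.ite (cst natE natE (2 : ℕ)) (cst natE natE (3 : ℕ)))
  exact h.congr fun k => by
    unfold modCode
    by_cases h1 : k = 1 ∧ m ≠ 1
    · simp [h1]
    · rw [if_neg h1]
      have e1 : (decide (id k = 1) && decide (m ≠ 1)) = false := by
        simpa [Bool.and_eq_false_iff, not_and_or] using h1
      simp only [e1, Bool.false_eq_true, if_false]
      by_cases h2 : m = 0 ∨ k < m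
      · rw [if_pos h2]
        rcases h2 with h2 | h2 <;> simp [h2]
      · rw [if_neg h2]
        simp only [not_or, not_lt] at h2
        simp [h2.1, not_lt.2 h2.2]

/-- `canon m` on codes. [folklore] -/
theorem canon_code (m : ℕ) : CodeFP (pairE natE natE) natE (fun p => canon m p.1 p.2) := by
  have hc : CodeFP (pairE natE natE) natE (fun p => p.1) := fst natE natE
  have hk : CodeFP (pairE natE natE) natE (fun p => p.2) := snd natE natE
  have e0 := natEq.comp (hc.pair (cst (pairE natE natE) natE (0 : ℕ)))
  have e1 := natEq.comp (hc.pair (cst (pairE natE natE) natE (1 : ℕ)))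
  have e2 := natEq.comp (hc.pair (cst (pairE natE natE) natE (2 : ℕ)))
  have h := e0.ite (cst (pairE natE natE) natE (0 : ℕ)) (e1.ite (cst (pairE natE natE) natE (1 : ℕ))
    (e2.ite (orCode_code.comp hk) ((modCode_code m).comp hk)))
  exact h.congr fun p => by
    unfold canon
    by_cases h0 : p.1 = 0
    · simp [h0]
    · by_cases h1 : p.1 = 1
      · simp [h1]
      · by_cases h2 : p.1 = 2
        · simp [h2]
        · simp [h0, h1, h2]

/-- `canonC m` on codes. [folklore] -/
theorem canonC_code (m : ℕ) : CodeFP gateE gateE (canonC m) := by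
  have hc : CodeFP gateE natE (fun g => g.1) := fst natE (rawE wireE)
  have hws : CodeFP gateE (rawE wireE) (fun g => g.2) := snd natE (rawE wireE)
  have h := ((canon_code m).comp (hc.pair ((natLength wireE).comp hws))).pair hws
  exact h.congr fun _ => rfl

/-- `wireOK` unfolded into `decide`s. [folklore] -/
theorem wireOK_eq (n j : ℕ) (p : WireC) : wireOK n j p =
    ((decide (p.1 = 0) && decide (p.2 < n)) || (decide (p.1 = 1) && decide (p.2 < j))) := by
  simp [wireOK, beq_eq_decide]

/-- `wireOK` on codes, context `(n, j)`. [folklore] -/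
theorem wireOK_code : CodeFP (pairE (pairE natE natE) wireE) bitE (fun p => wireOK p.1.1 p.1.2 p.2) := by
  have hn : CodeFP (pairE (pairE natE natE) wireE) natE (fun p => p.1.1) := p11 natE natE wireE
  have hj : CodeFP (pairE (pairE natE natE) wireE) natE (fun p => p.1.2) := p12 natE natE wireE
  have ht : CodeFP (pairE (pairE natE natE) wireE) natE (fun p => p.2.1) := p21 (pairE natE natE) natE natE
  have hi : CodeFP (pairE (pairE natE natE) wireE) natE (fun p => p.2.2) := p22 (pairE natE natE) natE natE
  have h := ((natEq.comp (ht.pair (cst (pairE (pairE natE natE) wireE) natE (0 : ℕ)))).and (natLt.comp (hi.pair hn))).or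
    ((natEq.comp (ht.pair (cst (pairE (pairE natE natE) wireE) natE (1 : ℕ)))).and (natLt.comp (hi.pair hj)))
  exact h.congr fun p => by rw [wireOK_eq]

/-- `gateOK` unfolded into `decide`s. [folklore] -/
theorem gateOK_eq (n j : ℕ) (g : GateC) : gateOK n j g =
    (decide (g.1 ≤ 3) && (!decide (g.1 = 0) || decide (g.2.length = 1)) && g.2.all (wireOK n j)) := by
  simp [gateOK, beq_eq_decide]

/-- `gateOK` on codes, context `(n, j)`. [folklore] -/
theorem gateOK_code : CodeFP (pairE (pairE natE natE) gateE) bitE (fun p => gateOK p.1.1 p.1.2 p.2) := by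
  have hctx : CodeFP (pairE (pairE natE natE) gateE) (pairE natE natE) (fun p => p.1) := fst (pairE natE natE) gateE
  have hc : CodeFP (pairE (pairE natE natE) gateE) natE (fun p => p.2.1) := p21 (pairE natE natE) natE (rawE wireE)
  have hws : CodeFP (pairE (pairE natE natE) gateE) (rawE wireE) (fun p => p.2.2) := p22 (pairE natE natE) natE (rawE wireE)
  have hall := (all wireOK_code).comp (hctx.pair hws)
  have h := ((natLe.comp (hc.pair (cst (pairE (pairE natE natE) gateE) natE (3 : ℕ)))).and
    ((natEq.comp (hc.pair (cst (pairE (pairE natE natE) gateE) natE (0 : ℕ)))).not.or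
      (natEq.comp (((natLength wireE).comp hws).pair (cst (pairE (pairE natE natE) gateE) natE (1 : ℕ)))))).and hall
  exact h.congr fun p => by rw [gateOK_eq]

/-! ### The depth table and the validity test are computed on codes -/

/-- The maximum of a list of naturals as a left fold. [folklore] -/
def maxL (l : List ℕ) : ℕ := l.foldl max 0

/-- A left `max`-fold is the `max` with the left `max`-fold from `0`. [folklore] -/
theorem foldl_max_eq (b : ℕ) (l : List ℕ) : l.foldl max b = max b (l.foldl max 0) := by
  induction l generalizing b with
  | nil => simp
  | cons a l ih => rw [List.foldl_cons, List.foldl_cons, ih, ih (max 0 a)]; simp [max_assoc]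

/-- The right `max`-fold from `0` is `maxL`. [folklore] -/
theorem foldr_max_eq_maxL (l : List ℕ) : l.foldr max 0 = maxL l := by
  induction l with
  | nil => rfl
  | cons a l ih =>
    rw [List.foldr_cons, ih, maxL, maxL, List.foldl_cons, foldl_max_eq (max 0 a)]
    simp

/-- A left `max`-fold is the initial value or a member. [folklore] -/
theorem foldl_max_mem (b : ℕ) (l : List ℕ) : l.foldl max b = b ∨ l.foldl max b ∈ l := by
  induction l generalizing b with
  | nil => exact Or.inl rfl
  | cons a l ih =>
    rw [List.foldl_cons]
    rcases ih (max b a) with h | h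
    · rw [h]
      rcases le_total a b with hab | hab
      · exact Or.inl (max_eq_left hab)
      · exact Or.inr (by rw [max_eq_right hab]; exact List.mem_cons_self)
    · exact Or.inr (List.mem_cons_of_mem _ h)

/-- `maxL` on codes. [folklore] -/
theorem maxL_code : CodeFP (rawE natE) natE maxL := by
  have hstep := natMax.comp ((snd natE natE).pair (fst natE natE))
  have h := foldl₀ (eα := natE) (eβ := natE) (step := fun (a : ℕ) (b : ℕ) => max b a) (b₀ := 0) hstep X
    (fun l₁ l₂ => by
      rw [eval_X]
      rcases foldl_max_mem 0 l₁ with h | h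
      · simp only [show (fun (b a : ℕ) => max b a) = max from rfl] at h ⊢
        rw [h]; exact Nat.zero_le _
      · simp only [show (fun (b a : ℕ) => max b a) = max from rfl] at h ⊢
        have := length_item_le_length_rawE natE (List.mem_append_left l₂ h)
        omega)
  exact h.congr fun l => rfl

/-- `wdC` on codes. [folklore] -/
theorem wdC_code : CodeFP (pairE (rawE natE) wireE) natE (fun t => wdC t.1 t.2) := by
  have hds : CodeFP (pairE (rawE natE) wireE) (rawE natE) (fun t => t.1) := fst (rawE natE) wireE
  have ht : CodeFP (pairE (rawE natE) wireE) natE (fun t => t.2.1) := p21 (rawE natE) natE natE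
  have hi : CodeFP (pairE (rawE natE) wireE) natE (fun t => t.2.2) := p22 (rawE natE) natE natE
  have hc := natEq.comp (ht.pair (cst (pairE (rawE natE) wireE) natE (0 : ℕ)))
  have hget := (rawGetD natE (d := 0) rfl).comp (hds.pair hi)
  have h := hc.ite (cst (pairE (rawE natE) wireE) natE (0 : ℕ)) hget
  exact h.congr fun t => by
    by_cases h0 : t.2.1 = 0 <;> simp [wdC, h0]

/-- `gateDepthC` on codes. [folklore] -/
theorem gateDepthC_code : CodeFP (pairE (rawE natE) gateE) natE (fun t => gateDepthC t.1 t.2) := by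
  have hds : CodeFP (pairE (rawE natE) gateE) (rawE natE) (fun t => t.1) := fst (rawE natE) gateE
  have hc : CodeFP (pairE (rawE natE) gateE) natE (fun t => t.2.1) := p21 (rawE natE) natE (rawE wireE)
  have hws : CodeFP (pairE (rawE natE) gateE) (rawE wireE) (fun t => t.2.2) := p22 (rawE natE) natE (rawE wireE)
  have hw := (natEq.comp (hc.pair (cst (pairE (rawE natE) gateE) natE (0 : ℕ)))).ite
    (cst (pairE (rawE natE) gateE) natE (0 : ℕ)) (cst (pairE (rawE natE) gateE) natE (1 : ℕ))
  have hm := maxL_code.comp ((map wdC_code).comp (hds.pair hws))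
  have h := natAdd.comp (hw.pair hm)
  exact h.congr fun t => by
    simp only [gateDepthC, foldr_max_eq_maxL]
    by_cases h0 : t.2.1 = 0 <;> simp [h0]

/-- The entries of the depth table are at most the number of gates. [folklore] -/
theorem depthsC_le : ∀ (gs : List GateC), ∀ x ∈ depthsC gs, x ≤ gs.length := by
  intro gs
  induction gs using List.reverseRecOn with
  | nil => simp [depthsC]
  | append_singleton gs g ih =>
    intro x hx
    rw [depthsC_append_singleton, List.mem_append, List.mem_singleton] at hx
    rw [List.length_append, List.length_singleton]
    rcases hx with hx | rfl
    · exact (ih x hx).trans (Nat.le_succ _)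
    · unfold gateDepthC
      have hmax : (g.2.map (wdC (depthsC gs))).foldr max 0 ≤ gs.length := by
        refine foldr_max_zero_le fun y hy => ?_
        obtain ⟨p, -, rfl⟩ := List.mem_map.1 hy
        unfold wdC
        split_ifs
        · exact Nat.zero_le _
        · rw [List.getD_eq_getElem?_getD]
          cases h : (depthsC gs)[p.2]? with
          | none => simp
          | some v => simpa using ih v (List.mem_of_getElem? h)
      split_ifs <;> omega

/-- The depth table has one entry per gate. [folklore] -/
theorem length_depthsC (gs : List GateC) : (depthsC gs).length = gs.length := by
  induction gs using List.reverseRecOn with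
  | nil => rfl
  | append_singleton gs g ih => rw [depthsC_append_singleton]; simp [ih]

/-- `depthsC` on codes (a fold; the accumulator holds `|gs|` numerals `≤ |gs|`). [folklore] -/
theorem depthsC_code : CodeFP (rawE gateE) (rawE natE) depthsC := by
  have hds : CodeFP (pairE gateE (rawE natE)) (rawE natE) (fun t => t.2) := snd gateE (rawE natE)
  have hg : CodeFP (pairE gateE (rawE natE)) gateE (fun t => t.1) := fst gateE (rawE natE)
  have hstep := (rawAppend natE).comp (hds.pair ((rawSingleton natE).comp (gateDepthC_code.comp (hds.pair hg))))
  have h := foldl₀ (eα := gateE) (eβ := rawE natE) (step := fun (g : GateC) (ds : List ℕ) => ds ++ [gateDepthC ds g])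
    (b₀ := []) hstep (X * (2 * X + 2)) (fun l₁ l₂ => by
      have hfold : l₁.foldl (fun (b : List ℕ) (a : GateC) => b ++ [gateDepthC b a]) [] = depthsC l₁ := rfl
      rw [hfold]
      set L := (rawE gateE (l₁ ++ l₂)).length with hL
      have hl₁ : l₁.length ≤ L := by
        have := length_le_length_rawE gateE (l₁ ++ l₂)
        rw [List.length_append] at this
        omega
      rw [length_rawE]
      have hitem : ∀ y ∈ (depthsC l₁).map (fun a => 2 * (natE a).length + 2), y ≤ 2 * L + 2 := by
        intro y hy
        obtain ⟨x, hx, rfl⟩ := List.mem_map.1 hy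
        have h1 := length_natE_le x
        have h2 := depthsC_le l₁ x hx
        omega
      have hsum := List.sum_le_card_nsmul _ _ hitem
      rw [List.length_map, length_depthsC, smul_eq_mul] at hsum
      simp only [eval_mul, eval_add, eval_X, eval_ofNat]
      exact hsum.trans (Nat.mul_le_mul_right _ hl₁))
  exact h.congr fun l => rfl

/-- The position scan of `gatesOK`: from `(j, ok)` over `gs` to `(j + |gs|, ok ∧ gatesOK n j gs)`.
[folklore] -/
theorem foldl_gatesOK (n : ℕ) : ∀ (gs : List GateC) (j : ℕ) (ok : Bool),
    gs.foldl (fun (st : ℕ × Bool) g => (st.1 + 1, st.2 && gateOK n st.1 g)) (j, ok) =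
      (j + gs.length, ok && gatesOK n j gs)
  | [], j, ok => by simp [gatesOK]
  | g :: gs, j, ok => by
    rw [List.foldl_cons, foldl_gatesOK n gs (j + 1) _, gatesOK]
    simp [Bool.and_assoc, Nat.add_assoc, Nat.add_comm 1]

/-- `gatesOK n 0` on codes (context `n`). [folklore] -/
theorem gatesOK_code : CodeFP (pairE natE (rawE gateE)) bitE (fun p => gatesOK p.1 0 p.2) := by
  -- step argument `(n, g, (j, ok))`
  have hn : CodeFP (pairE natE (pairE gateE (pairE natE bitE))) natE (fun t => t.1) := fst natE _
  have hg : CodeFP (pairE natE (pairE gateE (pairE natE bitE))) gateE (fun t => t.2.1) := p21 natE gateE (pairE natE bitE)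
  have hj : CodeFP (pairE natE (pairE gateE (pairE natE bitE))) natE (fun t => t.2.2.1) :=
    (p22 natE gateE (pairE natE bitE)).fst'
  have hok : CodeFP (pairE natE (pairE gateE (pairE natE bitE))) bitE (fun t => t.2.2.2) :=
    (p22 natE gateE (pairE natE bitE)).snd'
  have hstep := (natAdd.comp (hj.pair (cst (pairE natE (pairE gateE (pairE natE bitE))) natE (1 : ℕ)))).pair
    (hok.and (gateOK_code.comp ((hn.pair hj).pair hg)))
  have h := foldl (eσ := natE) (eα := gateE) (eβ := pairE natE bitE)
    (step := fun (n : ℕ) (g : GateC) (st : ℕ × Bool) => (st.1 + 1, st.2 && gateOK n st.1 g))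
    (init := fun _ => ((0 : ℕ), true)) hstep (cst natE (pairE natE bitE) ((0 : ℕ), true)) (2 * X + 3)
    (fun n l₁ l₂ => by
      rw [foldl_gatesOK, pairE_apply, length_boolPair, Nat.zero_add]
      have h1 := length_natE_le l₁.length
      have h2 : l₁.length ≤ (pairE natE (rawE gateE) (n, l₁ ++ l₂)).length := by
        rw [pairE_apply, length_boolPair]
        have := length_le_length_rawE gateE (l₁ ++ l₂)
        rw [List.length_append] at this
        simp only
        omega
      simp only [eval_add, eval_mul, eval_X, eval_ofNat, bitE, List.length_singleton] at h2 ⊢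
      omega)
  exact h.snd'.congr fun p => by simp [foldl_gatesOK]

/-- The code of the arguments of the validity test: `(n, sz, out, gs)`. [folklore] -/
abbrev validInE : ℕ × ℕ × WireC × List GateC → List Bool := pairE natE (pairE natE (pairE wireE (rawE gateE)))

/-- `validC n dW sz out gs` on codes (`dW` a constant of the program). [folklore] -/
theorem validC_code (dW : ℕ) : CodeFP validInE bitE (fun p => validC p.1 dW p.2.1 p.2.2.1 p.2.2.2) := by
  have hn : CodeFP validInE natE (fun p => p.1) := fst natE _
  have hsz : CodeFP validInE natE (fun p => p.2.1) := p21 natE natE _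
  have hout : CodeFP validInE wireE (fun p => p.2.2.1) := (p22 natE natE (pairE wireE (rawE gateE))).fst'
  have hgs : CodeFP validInE (rawE gateE) (fun p => p.2.2.2) := (p22 natE natE (pairE wireE (rawE gateE))).snd'
  have hlen := (natLength gateE).comp hgs
  have h1 := gatesOK_code.comp (hn.pair hgs)
  have h2 := wireOK_code.comp ((hn.pair hlen).pair hout)
  have h3 := natLe.comp (hlen.pair hsz)
  have h4 := natLe.comp ((wdC_code.comp ((depthsC_code.comp hgs).pair hout)).pair (cst validInE natE dW))
  have h := ((h1.and h2).and h3).and h4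
  exact h.congr fun p => by simp only [validC]

/-- `wSize e` on codes (`e` a constant of the program; the exponent is fed in unary). [folklore] -/
theorem wSize_code (e : ℕ) : CodeFP natE natE (wSize e) := by
  have hpow := natPow.comp ((CodeFP.id natE).pair (cst natE unE e))
  have h := natAdd.comp ((natAdd.comp ((natAdd.comp (hpow.pair (cst natE natE e))).pair (CodeFP.id natE))).pair
    (cst natE natE (2 : ℕ)))
  exact h.congr fun n => by simp [wSize]

/-! ### The parser is computed on codes -/

/-- The parser state as a tuple. [folklore] -/
abbrev PT : Type := List ℕ × ℕ × Bool × List (List ℕ)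

/-- The code of a parser state. [folklore] -/
abbrev ptE : PT → List Bool := pairE (rawE natE) (pairE natE (pairE bitE (rawE (rawE natE))))

/-- A parser state as a tuple. [folklore] -/
def PS.toT (s : PS) : PT := (s.cur, s.need, s.wait, s.done)

/-- `pstep` on tuples. [folklore] -/
def pstepT (st : PT) (x : ℕ) : PT :=
  if st.1.isEmpty then ([x], 0, true, st.2.2.2)
  else if st.2.2.1 then
    (if x = 0 then ([], 0, false, st.2.2.2 ++ [st.1 ++ [x]]) else (st.1 ++ [x], 2 * x, false, st.2.2.2))
  else
    (if st.2.1 ≤ 1 then ([], 0, false, st.2.2.2 ++ [st.1 ++ [x]]) else (st.1 ++ [x], st.2.1 - 1, false, st.2.2.2))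

/-- `pstepT` is `pstep` on tuples. [folklore] -/
theorem toT_pstep (s : PS) (x : ℕ) : (pstep s x).toT = pstepT s.toT x := by
  simp only [pstep, pstepT, PS.toT, List.isEmpty_iff]
  split_ifs <;> rfl

/-- `parseFlat` on tuples. [folklore] -/
theorem toT_foldl_pstep (l : List ℕ) : ∀ s : PS, (l.foldl pstep s).toT = l.foldl pstepT s.toT := by
  induction l with
  | nil => intro s; rfl
  | cons x l ih => intro s; rw [List.foldl_cons, List.foldl_cons, ih, toT_pstep]

/-- `parseFlat` on tuples. [folklore] -/
theorem toT_parseFlat (l : List ℕ) : (parseFlat l).toT = l.foldl pstepT ([], 0, false, []) :=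
  toT_foldl_pstep l ⟨[], 0, false, []⟩

/-- Invariant 1: the parser holds exactly what it has read. [folklore] -/
theorem pstepT_read (l : List ℕ) : ∀ st : PT,
    (l.foldl pstepT st).2.2.2.flatten ++ (l.foldl pstepT st).1 = st.2.2.2.flatten ++ st.1 ++ l := by
  induction l with
  | nil => intro st; simp
  | cons x l ih =>
    intro st
    rw [List.foldl_cons, ih]
    unfold pstepT
    split_ifs with h1 <;> simp_all [List.isEmpty_iff]

/-- Invariant 2: the wanted count is at most twice a natural read (or the initial one). [folklore] -/
theorem pstepT_need (l : List ℕ) : ∀ st : PT,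
    (l.foldl pstepT st).2.1 ≤ max st.2.1 (2 * l.foldr max 0) := by
  induction l with
  | nil => intro st; simp
  | cons x l ih =>
    intro st
    rw [List.foldl_cons, List.foldr_cons]
    refine (ih _).trans ?_
    unfold pstepT
    split_ifs <;> simp
    all_goals omega

/-- Invariant 3: at most one gate is completed per natural read. [folklore] -/
theorem pstepT_done (l : List ℕ) : ∀ st : PT,
    (l.foldl pstepT st).2.2.2.length ≤ st.2.2.2.length + l.length := by
  induction l with
  | nil => intro st; simp
  | cons x l ih =>
    intro st
    rw [List.foldl_cons]
    refine (ih _).trans ?_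
    unfold pstepT
    split_ifs <;> simp <;> omega

/-- The raw code of a flattened list of lists. [folklore] -/
theorem length_rawE_flatten (e : ℕ → List Bool) (L : List (List ℕ)) :
    (rawE e L.flatten).length = (L.map fun d => (rawE e d).length).sum := by
  induction L with
  | nil => rfl
  | cons d L ih => rw [List.flatten_cons, rawE_append, List.length_append, ih, List.map_cons, List.sum_cons]

/-- The raw code of a list of lists, from the codes of its items. [folklore] -/
theorem length_rawE_rawE (e : ℕ → List Bool) (L : List (List ℕ)) :
    (rawE (rawE e) L).length = 2 * (L.map fun d => (rawE e d).length).sum + 2 * L.length := by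
  rw [length_rawE]
  induction L with
  | nil => rfl
  | cons d L ih => simp only [List.map_cons, List.sum_cons, List.length_cons] at ih ⊢; omega

/-- `natE` is monotone in length. [folklore] -/
theorem length_natE_mono {a b : ℕ} (h : a ≤ b) : (natE a).length ≤ (natE b).length := by
  show (encodeNat a).length ≤ (encodeNat b).length
  rw [TM2Pass.length_encodeNat_eq_size, TM2Pass.length_encodeNat_eq_size]
  exact Nat.size_le_size h

/-- `pstepT` on codes. [folklore] -/
theorem pstepT_code : CodeFP (pairE ptE natE) ptE (fun t => pstepT t.1 t.2) := by
  have hcur : CodeFP (pairE ptE natE) (rawE natE) (fun t => t.1.1) := p11 (rawE natE) _ natE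
  have hneed : CodeFP (pairE ptE natE) natE (fun t => t.1.2.1) := (p12 (rawE natE) _ natE).fst'
  have hwait : CodeFP (pairE ptE natE) bitE (fun t => t.1.2.2.1) := (p12 (rawE natE) _ natE).snd'.fst'
  have hdone : CodeFP (pairE ptE natE) (rawE (rawE natE)) (fun t => t.1.2.2.2) := (p12 (rawE natE) _ natE).snd'.snd'
  have hx : CodeFP (pairE ptE natE) natE (fun t => t.2) := snd ptE natE
  -- pieces
  have hcurx := (rawAppend natE).comp (hcur.pair ((rawSingleton natE).comp hx))
  have hdone' := (rawAppend (rawE natE)).comp (hdone.pair ((rawSingleton (rawE natE)).comp hcurx))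
  have hF : CodeFP (pairE ptE natE) bitE (fun _ => false) := cst _ bitE false
  have hT : CodeFP (pairE ptE natE) bitE (fun _ => true) := cst _ bitE true
  have h0 : CodeFP (pairE ptE natE) natE (fun _ => (0 : ℕ)) := cst _ natE 0
  have hnil : CodeFP (pairE ptE natE) (rawE natE) (fun _ => ([] : List ℕ)) := cst _ (rawE natE) []
  -- the five new states
  have sA := ((rawSingleton natE).comp hx).pair (h0.pair (hT.pair hdone))
  have sB := hnil.pair (h0.pair (hF.pair hdone'))
  have sC := hcurx.pair ((natMul.comp ((cst (pairE ptE natE) natE (2 : ℕ)).pair hx)).pair (hF.pair hdone))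
  have sD := hcurx.pair ((natSub.comp (hneed.pair (cst (pairE ptE natE) natE (1 : ℕ)))).pair (hF.pair hdone))
  -- conditions
  have c1 := (rawIsEmpty natE).comp hcur
  have c2 := natEq.comp (hx.pair h0)
  have c3 := natLe.comp (hneed.pair (cst (pairE ptE natE) natE (1 : ℕ)))
  have h := c1.ite sA (hwait.ite (c2.ite sB sC) (c3.ite sB sD))
  exact h.congr fun t => by
    simp only [pstepT]
    by_cases e1 : t.1.1.isEmpty = true
    · simp [e1]
    · simp only [e1, Bool.false_eq_true, if_false]
      by_cases e2 : t.1.2.2.1 = true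
      · by_cases e3 : t.2 = 0 <;> simp [e2, e3]
      · by_cases e3 : t.1.2.1 ≤ 1 <;> simp [e2, e3]

/-- **The parser on codes** (a fold; its state holds what it has read). [folklore] -/
theorem parseT_code : CodeFP (rawE natE) ptE (fun l => l.foldl pstepT ([], 0, false, [])) := by
  have hstep := pstepT_code.comp ((snd natE ptE).pair (fst natE ptE))
  have h := foldl₀ (eα := natE) (eβ := ptE) (step := fun (x : ℕ) (st : PT) => pstepT st x)
    (b₀ := (([] : List ℕ), (0 : ℕ), false, ([] : List (List ℕ)))) hstep (8 * X + 14) (fun l₁ l₂ => by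
      set st := l₁.foldl (fun (b : PT) (a : ℕ) => pstepT b a) ([], 0, false, []) with hst
      set L := (rawE natE (l₁ ++ l₂)).length with hL
      have hread := pstepT_read l₁ ([], 0, false, [])
      have hneed := pstepT_need l₁ ([], 0, false, [])
      have hdone := pstepT_done l₁ ([], 0, false, [])
      simp only [List.flatten_nil, List.nil_append, Nat.zero_add, List.length_nil] at hread hneed hdone
      rw [← hst] at hread hneed hdone
      -- the read part
      have hsum : (rawE natE st.2.2.2.flatten).length + (rawE natE st.1).length = (rawE natE l₁).length := by
        rw [← List.length_append, ← rawE_append, hread]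
      have hl₁ : (rawE natE l₁).length ≤ L := length_rawE_le_of_sublist _ (List.sublist_append_left l₁ l₂)
      -- the wanted count
      have hmax : (natE (l₁.foldr max 0)).length ≤ L := by
        rcases foldl_max_mem 0 l₁ with h | h
        · rw [foldr_max_eq_maxL, maxL, h]; exact Nat.zero_le _
        · rw [foldr_max_eq_maxL, maxL]
          have := length_item_le_length_rawE natE (List.mem_append_left l₂ h)
          omega
      have hn : (natE st.2.1).length ≤ L + 2 := by
        have h1 := length_natE_mul_le 2 (l₁.foldr max 0)
        have h2 : (natE st.2.1).length ≤ (natE (2 * l₁.foldr max 0)).length :=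
          length_natE_mono (by simpa using hneed)
        have h3 : (natE 2).length = 2 := by decide
        omega
      have hcnt : st.2.2.2.length ≤ L := by
        have h1 := length_le_length_rawE natE (l₁ ++ l₂)
        rw [List.length_append] at h1
        omega
      rw [show ptE st = pairE (rawE natE) (pairE natE (pairE bitE (rawE (rawE natE)))) st from rfl, pairE_apply,
        length_boolPair, pairE_apply, length_boolPair, pairE_apply, length_boolPair, length_rawE_rawE,
        ← length_rawE_flatten]
      simp only [eval_add, eval_mul, eval_X, eval_ofNat, bitE, List.length_singleton]
      omega)
  exact h.congr fun l => rfl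

/-! ### Pairing the wire fields: a split fold and a zip -/

/-- The split step: alternately collect into the even and the odd part. [folklore] -/
def stepS (x : ℕ) (st : Bool × List ℕ × List ℕ) : Bool × List ℕ × List ℕ :=
  if st.1 then (false, st.2.1, st.2.2 ++ [x]) else (true, st.2.1 ++ [x], st.2.2)

/-- Two naturals advance the split by one pair. [folklore] -/
theorem foldl_stepS_cons_cons (t i : ℕ) (rest ev od : List ℕ) :
    (t :: i :: rest).foldl (fun st x => stepS x st) (false, ev, od) =
      rest.foldl (fun st x => stepS x st) (false, ev ++ [t], od ++ [i]) := by
  simp [List.foldl_cons, stepS]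

/-- The parts are sublists of what was read (with the initial parts in front). [folklore] -/
theorem stepS_sublist : ∀ (l : List ℕ) (b : Bool) (ev od : List ℕ),
    (ev ++ l).Sublist (ev ++ l) ∧
    ((l.foldl (fun st x => stepS x st) (b, ev, od)).2.1.Sublist (ev ++ l)) ∧
    ((l.foldl (fun st x => stepS x st) (b, ev, od)).2.2.Sublist (od ++ l))
  | [], b, ev, od => by simp
  | x :: l, b, ev, od => by
    rw [List.foldl_cons]
    cases b
    · have ih := stepS_sublist l true (ev ++ [x]) od
      simp only [stepS, Bool.false_eq_true, if_false, List.append_assoc, List.singleton_append] at ih ⊢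
      exact ⟨List.Sublist.refl _, ih.2.1, ih.2.2.trans ((List.sublist_cons_self x l).append_left od)⟩
    · have ih := stepS_sublist l false ev (od ++ [x])
      simp only [stepS, if_true, List.append_assoc, List.singleton_append] at ih ⊢
      exact ⟨List.Sublist.refl _, ih.2.1.trans ((List.sublist_cons_self x l).append_left ev), ih.2.2⟩

/-- **`pairUp` is the zip of the two parts of the split.** [folklore] -/
theorem pairUp_eq_zip : ∀ (l : List ℕ) (ev od : List ℕ), ev.length = od.length →
    List.zipWith Prod.mk (l.foldl (fun st x => stepS x st) (false, ev, od)).2.1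
      (l.foldl (fun st x => stepS x st) (false, ev, od)).2.2 = List.zipWith Prod.mk ev od ++ pairUp l
  | [], ev, od, _ => by simp [pairUp]
  | [t], ev, od, h => by
    simp only [List.foldl_cons, List.foldl_nil, stepS, Bool.false_eq_true, if_false, pairUp, List.append_nil]
    conv_lhs => rw [← List.append_nil od]
    rw [List.zipWith_append h]
    simp
  | t :: i :: rest, ev, od, h => by
    rw [foldl_stepS_cons_cons, pairUp_eq_zip rest _ _ (by simp [h]), pairUp, List.zipWith_append h]
    simp

/-- `stepS` on codes. [folklore] -/
theorem stepS_code : CodeFP (pairE natE (pairE bitE (pairE (rawE natE) (rawE natE))))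
    (pairE bitE (pairE (rawE natE) (rawE natE))) (fun t => stepS t.1 t.2) := by
  have hx : CodeFP (pairE natE (pairE bitE (pairE (rawE natE) (rawE natE)))) natE (fun t => t.1) := fst natE _
  have hb : CodeFP (pairE natE (pairE bitE (pairE (rawE natE) (rawE natE)))) bitE (fun t => t.2.1) := p21 natE bitE _
  have hev : CodeFP (pairE natE (pairE bitE (pairE (rawE natE) (rawE natE)))) (rawE natE) (fun t => t.2.2.1) :=
    (p22 natE bitE (pairE (rawE natE) (rawE natE))).fst'
  have hod : CodeFP (pairE natE (pairE bitE (pairE (rawE natE) (rawE natE)))) (rawE natE) (fun t => t.2.2.2) :=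
    (p22 natE bitE (pairE (rawE natE) (rawE natE))).snd'
  have hsx := (rawSingleton natE).comp hx
  have s1 := (cst (pairE natE (pairE bitE (pairE (rawE natE) (rawE natE)))) bitE false).pair
    (hev.pair ((rawAppend natE).comp (hod.pair hsx)))
  have s2 := (cst (pairE natE (pairE bitE (pairE (rawE natE) (rawE natE)))) bitE true).pair
    (((rawAppend natE).comp (hev.pair hsx)).pair hod)
  have h := hb.ite s1 s2
  exact h.congr fun t => by
    cases hb' : t.2.1 <;> simp [stepS, hb']

/-- **The split on codes** (a fold; its parts are sublists of the input). [folklore] -/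
theorem split_code : CodeFP (rawE natE) (pairE bitE (pairE (rawE natE) (rawE natE)))
    (fun l => l.foldl (fun st x => stepS x st) (false, [], [])) := by
  have h := foldl₀ (eα := natE) (eβ := pairE bitE (pairE (rawE natE) (rawE natE))) (step := stepS)
    (b₀ := (false, ([] : List ℕ), ([] : List ℕ))) stepS_code (3 * X + 6) (fun l₁ l₂ => by
      obtain ⟨-, h1, h2⟩ := stepS_sublist l₁ false [] []
      simp only [List.nil_append] at h1 h2
      set st := l₁.foldl (fun (b : Bool × List ℕ × List ℕ) (a : ℕ) => stepS a b) (false, [], []) with hst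
      have e1 := length_rawE_le_of_sublist natE (h1.trans (List.sublist_append_left l₁ l₂))
      have e2 := length_rawE_le_of_sublist natE (h2.trans (List.sublist_append_left l₁ l₂))
      rw [pairE_apply, length_boolPair, pairE_apply, length_boolPair]
      simp only [eval_add, eval_mul, eval_X, eval_ofNat, bitE, List.length_singleton]
      omega)
  exact h.congr fun l => rfl

/-- `pairUp` on codes. [folklore] -/
theorem pairUp_code : CodeFP (rawE natE) (rawE wireE) pairUp := by
  have hz := zipWith (σ := Unit) (eσ := unitE) (eα := natE) (eβ := natE) (eγ := wireE)
    (g := fun t => (t.2.1, t.2.2)) ((p21 unitE natE natE).pair (p22 unitE natE natE))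
  have h := hz.comp ((cst (rawE natE) unitE ()).pair (split_code.snd'.fst'.pair split_code.snd'.snd'))
  exact h.congr fun l => by
    have := pairUp_eq_zip l [] [] rfl
    simpa using this

/-- `rawToGate` spelled out. [folklore] -/
theorem rawToGate_eq (r : List ℕ) : rawToGate r = (r.headD 0, pairUp (r.tail.tail)) := by
  rcases r with _ | ⟨c, _ | ⟨k, rest⟩⟩ <;> simp [rawToGate, pairUp]

/-- `rawToGate` on codes. [folklore] -/
theorem rawToGate_code : CodeFP (rawE natE) gateE rawToGate := by
  have h := (rawHeadD natE (d := 0) rfl).pair (pairUp_code.comp ((rawTail natE).comp (rawTail natE)))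
  exact h.congr fun r => by rw [rawToGate_eq]

/-! ### Deserialising, with a flag -/

/-- **Deserialising with a flag**: `(ok, n, out, gates)`, agreeing with `deserialize` when it
succeeds (`deserialize'_of_some`) and flagging its failure (`deserialize_of_flag`). [folklore] -/
def deserialize' (l : List ℕ) : Bool × ℕ × WireC × List GateC :=
  let st := (l.tail.tail.tail.tail).foldl pstepT ([], 0, false, [])
  (decide (4 ≤ l.length) && st.1.isEmpty && decide (st.2.2.2.length = l.tail.tail.tail.headD 0),
    l.headD 0, (l.tail.headD 0, l.tail.tail.headD 0), st.2.2.2.map rawToGate)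

/-- The flagged deserialiser agrees with `deserialize`. [folklore] -/
theorem deserialize_eq_deserialize' (l : List ℕ) :
    deserialize l = if (deserialize' l).1 then some (deserialize' l).2 else none := by
  match l with
  | [] => simp [deserialize, deserialize']
  | [_] => simp [deserialize, deserialize']
  | [_, _] => simp [deserialize, deserialize']
  | [_, _, _] => simp [deserialize, deserialize']
  | n :: t :: i :: sz :: rest =>
    have hT := toT_parseFlat rest
    simp only [PS.toT] at hT
    simp only [deserialize, deserialize', List.tail_cons, List.headD_cons, List.length_cons, ← hT]
    by_cases h1 : (parseFlat rest).cur = [] <;> by_cases h2 : (parseFlat rest).done.length = sz <;> simp [h1, h2]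

/-- A successful `deserialize` is the flagged value. [folklore] -/
theorem deserialize'_of_some {l : List ℕ} {v : ℕ × WireC × List GateC} (h : deserialize l = some v) :
    deserialize' l = (true, v) := by
  rw [deserialize_eq_deserialize'] at h
  rcases e : deserialize' l with ⟨b, w⟩
  rw [e] at h
  simp only at h
  split_ifs at h with hf
  simp only [Option.some.injEq] at h
  subst h
  simp [hf]

/-- A raised flag is a successful `deserialize`. [folklore] -/
theorem deserialize_of_flag {l : List ℕ} (h : (deserialize' l).1 = true) : deserialize l = some (deserialize' l).2 := by
  rw [deserialize_eq_deserialize', if_pos h]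

/-- `deserialize'` on codes. [folklore] -/
theorem deserialize'_code : CodeFP (rawE natE) (pairE bitE (pairE natE (pairE wireE (rawE gateE)))) deserialize' := by
  have h0 : CodeFP (rawE natE) natE (fun l => l.headD 0) := rawHeadD natE (d := 0) rfl
  have t1 : CodeFP (rawE natE) (rawE natE) (fun l => l.tail) := rawTail natE
  have t2 := t1.comp t1
  have t3 := t1.comp t2
  have t4 := t1.comp t3
  have hst := parseT_code.comp t4
  have hflag := ((natLe.comp ((cst (rawE natE) natE (4 : ℕ)).pair (natLength natE))).and
    ((rawIsEmpty natE).comp hst.fst')).and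
    (natEq.comp (((natLength (rawE natE)).comp hst.snd'.snd'.snd').pair (h0.comp t3)))
  have h := hflag.pair (h0.pair (((h0.comp t1).pair (h0.comp t2)).pair ((map₀ rawToGate_code).comp hst.snd'.snd'.snd')))
  exact h.congr fun l => by simp only [deserialize']

/-! ### Stage 0 by offsets instead of nested shifts -/

/-- Shifts compose additively. [folklore] -/
theorem shiftC_shiftC (a b : ℕ) (q : WireC) : shiftC a (shiftC b q) = shiftC (b + a) q := by
  unfold shiftC
  by_cases h : q.1 = 0
  · simp [h]
  · simp [h, Nat.add_assoc]

/-- The zero shift. [folklore] -/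
theorem shiftC_zero (q : WireC) : shiftC 0 q = q := by
  unfold shiftC; split_ifs <;> simp

/-- Gate shifts compose additively. [folklore] -/
theorem shiftGateC_shiftGateC (a b : ℕ) (g : GateC) : shiftGateC a (shiftGateC b g) = shiftGateC (b + a) g := by
  simp [shiftGateC, List.map_map, Function.comp_def, shiftC_shiftC]

/-- The zero gate shift. [folklore] -/
theorem shiftGateC_zero (g : GateC) : shiftGateC 0 g = g := by
  obtain ⟨c, ws⟩ := g
  simp only [shiftGateC, Prod.mk.injEq, true_and]
  conv_rhs => rw [← List.map_id ws]
  exact List.map_congr_left fun q _ => shiftC_zero q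

/-- The offset step: record the current offset, advance it by the block's size. [folklore] -/
def offsStep (b : WireC × List GateC) (st : List ℕ × ℕ) : List ℕ × ℕ := (st.1 ++ [st.2], st.2 + b.2.length)

/-- The offsets of the blocks, starting from `off`. [folklore] -/
def offsetsFrom (off : ℕ) : List (WireC × List GateC) → List ℕ
  | [] => []
  | b :: rest => off :: offsetsFrom (off + b.2.length) rest

/-- The offset fold computes `offsetsFrom`. [folklore] -/
theorem foldl_offsStep : ∀ (fam : List (WireC × List GateC)) (acc : List ℕ) (off : ℕ),
    fam.foldl (fun st b => offsStep b st) (acc, off) =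
      (acc ++ offsetsFrom off fam, off + (fam.map fun b => b.2.length).sum)
  | [], acc, off => by simp [offsetsFrom]
  | b :: rest, acc, off => by
    rw [List.foldl_cons, offsStep, foldl_offsStep rest]
    simp [offsetsFrom, Nat.add_assoc]

/-- Offsets are bounded by the final offset. [folklore] -/
theorem offsetsFrom_le : ∀ (fam : List (WireC × List GateC)) (off : ℕ),
    ∀ x ∈ offsetsFrom off fam, x ≤ off + (fam.map fun b => b.2.length).sum
  | [], off, x, hx => by simp [offsetsFrom] at hx
  | b :: rest, off, x, hx => by
    simp only [offsetsFrom, List.mem_cons] at hx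
    simp only [List.map_cons, List.sum_cons]
    rcases hx with rfl | hx
    · omega
    · have := offsetsFrom_le rest _ x hx; omega

/-- One offset per block. [folklore] -/
theorem length_offsetsFrom : ∀ (fam : List (WireC × List GateC)) (off : ℕ), (offsetsFrom off fam).length = fam.length
  | [], _ => rfl
  | _ :: rest, off => by simp [offsetsFrom, length_offsetsFrom rest]

/-- **Stage 0 by offsets**: the shifted blocks flattened, and the shifted output wires. [folklore] -/
def sGC' (fam : List (WireC × List GateC)) : List GateC × List WireC :=
  ((List.zipWith (fun b o => b.2.map (shiftGateC o)) fam (offsetsFrom 0 fam)).flatten,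
    List.zipWith (fun b o => shiftC o b.1) fam (offsetsFrom 0 fam))

/-- Stage 0 by offsets is `parBlocksC`, shifted by the starting offset. [folklore] -/
theorem zipWith_offsetsFrom : ∀ (fam : List (WireC × List GateC)) (off : ℕ),
    (List.zipWith (fun b o => b.2.map (shiftGateC o)) fam (offsetsFrom off fam)).flatten =
      (parBlocksC (fam.map fun b => (b.2, b.1))).1.map (shiftGateC off) ∧
    List.zipWith (fun b o => shiftC o b.1) fam (offsetsFrom off fam) =
      (parBlocksC (fam.map fun b => (b.2, b.1))).2.map (shiftC off)
  | [], off => by simp [offsetsFrom, parBlocksC]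
  | b :: rest, off => by
    obtain ⟨ih1, ih2⟩ := zipWith_offsetsFrom rest (off + b.2.length)
    simp only [offsetsFrom, List.zipWith_cons_cons, List.flatten_cons, List.map_cons, parBlocksC, List.map_append,
      List.map_map, ih1, ih2]
    refine ⟨?_, ?_⟩
    · congr 1
      exact List.map_congr_left fun g _ => by
        rw [Function.comp_apply, shiftGateC_shiftGateC, Nat.add_comm]
    · congr 1
      exact List.map_congr_left fun q _ => by
        rw [Function.comp_apply, shiftC_shiftC, Nat.add_comm]

/-- **Stage 0 by offsets is stage 0.** [folklore] -/
theorem sGC'_eq (fam : List (WireC × List GateC)) : sGC' fam = sGC fam := by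
  obtain ⟨h1, h2⟩ := zipWith_offsetsFrom fam 0
  rw [sGC', sGC, h1, h2]
  refine Prod.ext ?_ ?_
  · conv_rhs => rw [← List.map_id (parBlocksC _).1]
    exact List.map_congr_left fun g _ => shiftGateC_zero g
  · conv_rhs => rw [← List.map_id (parBlocksC _).2]
    exact List.map_congr_left fun q _ => shiftC_zero q

/-- The total size of the blocks is at most the length of their code. [folklore] -/
theorem sum_sizes_le_length (fam : List (WireC × List GateC)) :
    (fam.map fun b => b.2.length).sum ≤ (rawE blockE fam).length := by
  induction fam with
  | nil => simp
  | cons b fam ih =>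
    rw [List.map_cons, List.sum_cons, rawE_cons, length_boolPair]
    have : b.2.length ≤ (blockE b).length := by
      rw [show blockE b = boolPair (wireE b.1) (rawE gateE b.2) from rfl, length_boolPair]
      have := length_le_length_rawE gateE b.2
      omega
    omega

/-- The offsets on codes (a fold; offsets are bounded by the total size). [folklore] -/
theorem offsets_code : CodeFP (rawE blockE) (rawE natE) (offsetsFrom 0) := by
  have hacc : CodeFP (pairE blockE (pairE (rawE natE) natE)) (rawE natE) (fun t => t.2.1) := p21 blockE (rawE natE) natE
  have hoff : CodeFP (pairE blockE (pairE (rawE natE) natE)) natE (fun t => t.2.2) := p22 blockE (rawE natE) natE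
  have hgs : CodeFP (pairE blockE (pairE (rawE natE) natE)) (rawE gateE) (fun t => t.1.2) := (fst blockE _).snd'
  have hstep := ((rawAppend natE).comp (hacc.pair ((rawSingleton natE).comp hoff))).pair
    (natAdd.comp (hoff.pair ((natLength gateE).comp hgs)))
  have h := foldl₀ (eα := blockE) (eβ := pairE (rawE natE) natE) (step := offsStep)
    (b₀ := (([] : List ℕ), (0 : ℕ))) hstep (2 * (X * (2 * X + 2)) + 2 + X) (fun l₁ l₂ => by
      rw [foldl_offsStep, List.nil_append, Nat.zero_add, pairE_apply, length_boolPair]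
      set L := (rawE blockE (l₁ ++ l₂)).length with hL
      have htot : (l₁.map fun b => b.2.length).sum ≤ L :=
        (sum_sizes_le_length l₁).trans (length_rawE_le_of_sublist _ (List.sublist_append_left l₁ l₂))
      have hl₁ : l₁.length ≤ L := by
        have := length_le_length_rawE blockE (l₁ ++ l₂); rw [List.length_append] at this; omega
      have hitem : ∀ y ∈ (offsetsFrom 0 l₁).map (fun a => 2 * (natE a).length + 2), y ≤ 2 * L + 2 := by
        intro y hy
        obtain ⟨x, hx, rfl⟩ := List.mem_map.1 hy
        have h1 := length_natE_le x
        have h2 := offsetsFrom_le l₁ 0 x hx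
        omega
      have hsum := List.sum_le_card_nsmul _ _ hitem
      rw [List.length_map, length_offsetsFrom, smul_eq_mul] at hsum
      rw [length_rawE]
      have hn := length_natE_le ((l₁.map fun b => b.2.length).sum)
      simp only [eval_add, eval_mul, eval_X, eval_ofNat]
      nlinarith [hsum, hl₁, htot, hn])
  exact h.fst'.congr fun fam => by rw [foldl_offsStep]; simp

/-- Stage 0 by offsets on codes. [folklore] -/
theorem sGC'_code : CodeFP (rawE blockE) (pairE (rawE gateE) (rawE wireE)) sGC' := by
  have hz1 := zipWith (σ := Unit) (eσ := unitE) (eα := blockE) (eβ := natE) (eγ := rawE gateE)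
    (g := fun t => t.2.1.2.map (shiftGateC t.2.2))
    (((map shiftGateC_code).comp ((p22 unitE blockE natE).pair (p21 unitE blockE natE).snd')).congr fun _ => rfl)
  have hg2 := shiftC_code.comp ((p22 unitE blockE natE).pair (p21 unitE blockE natE).fst')
  have hz2 := zipWith (σ := Unit) (eσ := unitE) (eα := blockE) (eβ := natE) (eγ := wireE)
    (g := fun t => shiftC t.2.2 t.2.1.1) (hg2.congr fun _ => rfl)
  have hu : CodeFP (rawE blockE) unitE (fun _ => ()) := cst _ unitE ()
  have hargs := hu.pair ((CodeFP.id (rawE blockE)).pair offsets_code)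
  have h := ((flatten gateE).comp (hz1.comp hargs)).pair (hz2.comp hargs)
  exact h.congr fun fam => rfl

/-! ### The input tables of the copies of `W` -/

/-- The input table of the `ℓ`-th copy by a bounded range (equal to `rhoC` when the output table
is long enough, `rhoC'_eq`). [folklore] -/
def rhoC' (T : List WireC) (n ℓ : ℕ) : List WireC :=
  (List.range (min n T.length)).map fun i => T.getD (ℓ * (n + 2) + (i + 2)) (0, 0)

/-- `rhoC' = rhoC` for `n ≤ |T|`. [folklore] -/
theorem rhoC'_eq {T : List WireC} {n : ℕ} (h : n ≤ T.length) (ℓ : ℕ) : rhoC' T n ℓ = rhoC T n ℓ := by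
  rw [rhoC', rhoC, min_eq_left h]
  apply List.ext_getElem
  · simp
  · intro i h1 h2
    simp

/-- `rhoC'` on codes (`ℓ` a constant of the program). [folklore] -/
theorem rhoC'_code (ℓ : ℕ) : CodeFP (pairE (rawE wireE) natE) (rawE wireE) (fun p => rhoC' p.1 p.2 ℓ) := by
  -- item map with context `(T, n)`: `i ↦ T[ℓ (n + 2) + i + 2]`
  have hT : CodeFP (pairE (pairE (rawE wireE) natE) natE) (rawE wireE) (fun t => t.1.1) := p11 (rawE wireE) natE natE
  have hn : CodeFP (pairE (pairE (rawE wireE) natE) natE) natE (fun t => t.1.2) := p12 (rawE wireE) natE natE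
  have hi : CodeFP (pairE (pairE (rawE wireE) natE) natE) natE (fun t => t.2) := snd _ natE
  have hidx := natAdd.comp ((natMul.comp ((cst (pairE (pairE (rawE wireE) natE) natE) natE ℓ).pair
    (natAdd.comp (hn.pair (cst (pairE (pairE (rawE wireE) natE) natE) natE (2 : ℕ)))))).pair
    (natAdd.comp (hi.pair (cst (pairE (pairE (rawE wireE) natE) natE) natE (2 : ℕ)))))
  have hitem := (rawGetOr wireE).comp (hT.pair (hidx.pair (cst (pairE (pairE (rawE wireE) natE) natE) wireE ((0 : ℕ), (0 : ℕ)))))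
  have hrange := (brange wireE).comp ((fst (rawE wireE) natE).pair (snd (rawE wireE) natE))
  have h := (map hitem).comp ((CodeFP.id (pairE (rawE wireE) natE)).pair hrange)
  exact h.congr fun p => by simp [rhoC']

/-! ### The stages and the code of `D`, computed on codes -/

section StagesPrime

variable (n : ℕ) (fam : List (WireC × List GateC)) (wout : WireC) (wgs : List GateC)

/-- Stage 1 with `sGC'`, `rhoC'`. [folklore] -/
def s1C' : List GateC × WireC := plugC (sGC' fam).1 (rhoC' (sGC' fam).2 n 0) wgs wout
/-- Stage 2 with `sGC'`, `rhoC'`. [folklore] -/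
def s2C' : List GateC × WireC := plugC (s1C' n fam wout wgs).1 (rhoC' (sGC' fam).2 n 1) wgs wout
/-- Stage 3 with `sGC'`, `rhoC'`. [folklore] -/
def s3C' : List GateC × WireC := plugC (s2C' n fam wout wgs).1 (rhoC' (sGC' fam).2 n 2) wgs wout
/-- Stage 4 with `sGC'`, `rhoC'`. [folklore] -/
def s4C' : List GateC × WireC :=
  addSlotC (s3C' n fam wout wgs).1 (s1C' n fam wout wgs).2 ((sGC' fam).2.getD 1 (0, 0)) ((sGC' fam).2.getD 0 (0, 0))
/-- Stage 5 with `sGC'`, `rhoC'`. [folklore] -/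
def s5C' : List GateC × WireC :=
  addSlotC (s4C' n fam wout wgs).1 (s2C' n fam wout wgs).2 ((sGC' fam).2.getD (n + 2 + 1) (0, 0))
    ((sGC' fam).2.getD (n + 2) (0, 0))
/-- Stage 6 with `sGC'`, `rhoC'`. [folklore] -/
def s6C' : List GateC × WireC :=
  addSlotC (s5C' n fam wout wgs).1 (s3C' n fam wout wgs).2 ((sGC' fam).2.getD (2 * (n + 2) + 1) (0, 0))
    ((sGC' fam).2.getD (2 * (n + 2)) (0, 0))
/-- Stage 7 with `sGC'`, `rhoC'`. [folklore] -/
def s7C' : List GateC × WireC :=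
  or₃C (s6C' n fam wout wgs).1 (s4C' n fam wout wgs).2 (s5C' n fam wout wgs).2 (s6C' n fam wout wgs).2
/-- Stage 8 with `sGC'`, `rhoC'`. [folklore] -/
def s8C' : List GateC × WireC := notC (s7C' n fam wout wgs).1 (s7C' n fam wout wgs).2

/-- **The code of `circuit G W` by offsets and bounded ranges** (`= circuitC` when the output table
has at least `n` entries, `circuitC'_eq`). [folklore] -/
def circuitC' : List ℕ := serialize n (s8C' n fam wout wgs).2 (s8C' n fam wout wgs).1

variable {n fam}

/-- The primed stages are the stages when the output table is long enough. [folklore] -/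
theorem s8C'_eq (h : n ≤ (TC fam).length) : s8C' n fam wout wgs = s8C n fam wout wgs := by
  have hT : (sGC' fam).2 = TC fam := by rw [sGC'_eq]; rfl
  have hT' : n ≤ (sGC' fam).2.length := by rwa [hT]
  have e1 : s1C' n fam wout wgs = s1C n fam wout wgs := by rw [s1C', s1C, rhoC'_eq hT', hT, sGC'_eq]
  have e2 : s2C' n fam wout wgs = s2C n fam wout wgs := by rw [s2C', s2C, rhoC'_eq hT', hT, e1]
  have e3 : s3C' n fam wout wgs = s3C n fam wout wgs := by rw [s3C', s3C, rhoC'_eq hT', hT, e2]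
  have e4 : s4C' n fam wout wgs = s4C n fam wout wgs := by rw [s4C', s4C, e3, e1, hT]
  have e5 : s5C' n fam wout wgs = s5C n fam wout wgs := by rw [s5C', s5C, e4, e2, hT]
  have e6 : s6C' n fam wout wgs = s6C n fam wout wgs := by rw [s6C', s6C, e5, e3, hT]
  have e7 : s7C' n fam wout wgs = s7C n fam wout wgs := by rw [s7C', s7C, e6, e4, e5]
  rw [s8C', s8C, e7]

/-- **`circuitC' = circuitC` when the output table has at least `n` entries.** [folklore] -/
theorem circuitC'_eq (h : n ≤ (TC fam).length) : circuitC' n fam wout wgs = circuitC n fam wout wgs := by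
  rw [circuitC', circuitC, s8C'_eq wout wgs h]

end StagesPrime

/-- The output table of the printed family has `3 (w + 2) ≥ w` entries. [folklore] -/
theorem length_TC_famC (m : ℕ) {w : ℕ} (G : ClauseCoord w → Circuit (Fin w)) : w ≤ (TC (famC m G)).length := by
  rw [← (stG_code m G).2, List.length_map, WitnessCheck.stG, GateList.length_layerL_snd, List.length_ofFn]
  omega

/-- The code of the arguments of the stages: `(n, fam, wout, wgs)`. [folklore] -/
abbrev stagesInE : ℕ × List (WireC × List GateC) × WireC × List GateC → List Bool :=
  pairE natE (pairE (rawE blockE) (pairE wireE (rawE gateE)))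

/-- `flatGate` on codes. [folklore] -/
theorem flatGate_code : CodeFP gateE (rawE natE) flatGate := by
  have hc : CodeFP gateE natE (fun g => g.1) := fst natE (rawE wireE)
  have hws : CodeFP gateE (rawE wireE) (fun g => g.2) := snd natE (rawE wireE)
  have hpair : CodeFP wireE (rawE natE) (fun q => [q.1, q.2]) := by
    have h := (rawCons natE).comp ((fst natE natE).pair ((rawSingleton natE).comp (snd natE natE)))
    exact h.congr fun _ => rfl
  have h := (rawCons natE).comp (hc.pair ((rawCons natE).comp (((natLength wireE).comp hws).pair
    ((flatten natE).comp ((map₀ hpair).comp hws)))))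
  exact h.congr fun g => by simp [flatGate, List.flatMap_def]

/-- `serialize` on codes: `(n, out, gs) ↦ serialize n out gs`. [folklore] -/
theorem serialize_code : CodeFP (pairE natE (pairE wireE (rawE gateE))) (rawE natE) (fun p => serialize p.1 p.2.1 p.2.2) := by
  have hn : CodeFP (pairE natE (pairE wireE (rawE gateE))) natE (fun p => p.1) := fst natE _
  have ht : CodeFP (pairE natE (pairE wireE (rawE gateE))) natE (fun p => p.2.1.1) := (p21 natE wireE (rawE gateE)).fst'
  have hi : CodeFP (pairE natE (pairE wireE (rawE gateE))) natE (fun p => p.2.1.2) := (p21 natE wireE (rawE gateE)).snd'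
  have hgs : CodeFP (pairE natE (pairE wireE (rawE gateE))) (rawE gateE) (fun p => p.2.2) := p22 natE wireE (rawE gateE)
  have h := (rawCons natE).comp (hn.pair ((rawCons natE).comp (ht.pair ((rawCons natE).comp (hi.pair ((rawCons natE).comp
    (((natLength gateE).comp hgs).pair ((flatten natE).comp ((map₀ flatGate_code).comp hgs)))))))))
  exact h.congr fun p => by simp [serialize, List.flatMap_def]

section StageCodes

/-- The inputs of the stages on codes. [folklore] -/
theorem stIn_n : CodeFP stagesInE natE (fun p => p.1) := fst natE _
/-- The inputs of the stages on codes. [folklore] -/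
theorem stIn_fam : CodeFP stagesInE (rawE blockE) (fun p => p.2.1) := p21 natE (rawE blockE) _
/-- The inputs of the stages on codes. [folklore] -/
theorem stIn_wout : CodeFP stagesInE wireE (fun p => p.2.2.1) := (p22 natE (rawE blockE) (pairE wireE (rawE gateE))).fst'
/-- The inputs of the stages on codes. [folklore] -/
theorem stIn_wgs : CodeFP stagesInE (rawE gateE) (fun p => p.2.2.2) := (p22 natE (rawE blockE) (pairE wireE (rawE gateE))).snd'

/-- Stage 0 of the inputs on codes. [folklore] -/
theorem stIn_sG : CodeFP stagesInE (pairE (rawE gateE) (rawE wireE)) (fun p => sGC' p.2.1) := sGC'_code.comp stIn_fam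

/-- The input tables of the copies of `W` on codes. [folklore] -/
theorem stIn_rho (ℓ : ℕ) : CodeFP stagesInE (rawE wireE) (fun p => rhoC' (sGC' p.2.1).2 p.1 ℓ) :=
  ((rhoC'_code ℓ).comp (stIn_sG.snd'.pair stIn_n)).congr fun _ => rfl

/-- Entries of the output table on codes (constant index). [folklore] -/
theorem stIn_get (k : ℕ) : CodeFP stagesInE wireE (fun p => (sGC' p.2.1).2.getD k (0, 0)) :=
  ((rawGetOr wireE).comp (stIn_sG.snd'.pair ((cst stagesInE natE k).pair (cst stagesInE wireE ((0 : ℕ), (0 : ℕ)))))).congr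
    fun _ => rfl

/-- Entries of the output table on codes (index `a (n + 2) + b`). [folklore] -/
theorem stIn_getn (a b : ℕ) : CodeFP stagesInE wireE (fun p => (sGC' p.2.1).2.getD (a * (p.1 + 2) + b) (0, 0)) := by
  have hidx := natAdd.comp ((natMul.comp ((cst stagesInE natE a).pair
    (natAdd.comp (stIn_n.pair (cst stagesInE natE (2 : ℕ)))))).pair (cst stagesInE natE b))
  have h := (rawGetOr wireE).comp (stIn_sG.snd'.pair (hidx.pair (cst stagesInE wireE ((0 : ℕ), (0 : ℕ)))))
  exact h.congr fun _ => rfl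

/-- Stage 1 on codes. [folklore] -/
theorem s1C'_code : CodeFP stagesInE (pairE (rawE gateE) wireE) (fun p => s1C' p.1 p.2.1 p.2.2.1 p.2.2.2) :=
  (plugC_code.comp (stIn_sG.fst'.pair ((stIn_rho 0).pair (stIn_wgs.pair stIn_wout)))).congr fun _ => rfl
/-- Stage 2 on codes. [folklore] -/
theorem s2C'_code : CodeFP stagesInE (pairE (rawE gateE) wireE) (fun p => s2C' p.1 p.2.1 p.2.2.1 p.2.2.2) :=
  (plugC_code.comp (s1C'_code.fst'.pair ((stIn_rho 1).pair (stIn_wgs.pair stIn_wout)))).congr fun _ => rfl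
/-- Stage 3 on codes. [folklore] -/
theorem s3C'_code : CodeFP stagesInE (pairE (rawE gateE) wireE) (fun p => s3C' p.1 p.2.1 p.2.2.1 p.2.2.2) :=
  (plugC_code.comp (s2C'_code.fst'.pair ((stIn_rho 2).pair (stIn_wgs.pair stIn_wout)))).congr fun _ => rfl
/-- Stage 4 on codes. [folklore] -/
theorem s4C'_code : CodeFP stagesInE (pairE (rawE gateE) wireE) (fun p => s4C' p.1 p.2.1 p.2.2.1 p.2.2.2) :=
  (addSlotC_code.comp (s3C'_code.fst'.pair (s1C'_code.snd'.pair ((stIn_get 1).pair (stIn_get 0))))).congr fun _ => rfl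
/-- Stage 5 on codes. [folklore] -/
theorem s5C'_code : CodeFP stagesInE (pairE (rawE gateE) wireE) (fun p => s5C' p.1 p.2.1 p.2.2.1 p.2.2.2) :=
  (addSlotC_code.comp (s4C'_code.fst'.pair (s2C'_code.snd'.pair ((stIn_getn 1 1).pair (stIn_getn 1 0))))).congr
    fun p => by simp only [s5C', one_mul, Nat.add_zero]
/-- Stage 6 on codes. [folklore] -/
theorem s6C'_code : CodeFP stagesInE (pairE (rawE gateE) wireE) (fun p => s6C' p.1 p.2.1 p.2.2.1 p.2.2.2) :=
  (addSlotC_code.comp (s5C'_code.fst'.pair (s3C'_code.snd'.pair ((stIn_getn 2 1).pair (stIn_getn 2 0))))).congr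
    fun p => by simp only [s6C', Nat.add_zero]
/-- Stage 7 on codes. [folklore] -/
theorem s7C'_code : CodeFP stagesInE (pairE (rawE gateE) wireE) (fun p => s7C' p.1 p.2.1 p.2.2.1 p.2.2.2) :=
  (or₃C_code.comp (s6C'_code.fst'.pair (s4C'_code.snd'.pair (s5C'_code.snd'.pair s6C'_code.snd')))).congr fun _ => rfl
/-- Stage 8 on codes. [folklore] -/
theorem s8C'_code : CodeFP stagesInE (pairE (rawE gateE) wireE) (fun p => s8C' p.1 p.2.1 p.2.2.1 p.2.2.2) :=
  (notC_code.comp (s7C'_code.fst'.pair s7C'_code.snd')).congr fun _ => rfl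

/-- **The code of `D` on codes**: `(n, fam, wout, wgs) ↦ circuitC' n fam wout wgs`. [folklore] -/
theorem circuitC'_code : CodeFP stagesInE (rawE natE) (fun p => circuitC' p.1 p.2.1 p.2.2.1 p.2.2.2) :=
  (serialize_code.comp (stIn_n.pair (s8C'_code.snd'.pair s8C'_code.fst'))).congr fun _ => rfl

end StageCodes

/-! ### The typed core of stage `F` -/

/-- The family of blocks read off the printed codes of the clause circuits (trusted codes: the
flag of `deserialize'` is not looked at). [folklore] -/
def famOf (fam : List (List ℕ)) : List (WireC × List GateC) :=
  fam.map fun code => ((deserialize' code).2.2.1, (deserialize' code).2.2.2)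

/-- **The typed core of stage `F`** at modulus `m`, depth bound `dW`, size exponent `e`: on the
list of the codes of the clause circuits and the decoded witness (a list of naturals), the flag
"the witness deserialises to a valid circuit on `w` inputs" (`w` read off the first clause code)
and, if raised, the code of the witness-check circuit on the canonicalised witness gates. [folklore] -/
def gCore (m dW e : ℕ) (p : List (List ℕ) × List ℕ) : Bool × List ℕ :=
  let w := (p.1.headD []).headD 0
  let d := deserialize' p.2
  let ok := d.1 && decide (d.2.1 = w) && validC w dW (wSize e w) d.2.2.1 d.2.2.2
  (ok, if ok then circuitC' w (famOf p.1) d.2.2.1 (d.2.2.2.map (canonC m)) else [])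

/-- `famOf` on codes. [folklore] -/
theorem famOf_code : CodeFP (rawE (rawE natE)) (rawE blockE) famOf := by
  have h := map₀ (deserialize'_code.snd'.snd'.fst'.pair deserialize'_code.snd'.snd'.snd')
  exact h.congr fun _ => rfl

/-- **The typed core on codes.** [folklore] -/
theorem gCore_code (m dW e : ℕ) : CodeFP (pairE (rawE (rawE natE)) (rawE natE)) (pairE bitE (rawE natE)) (gCore m dW e) := by
  have hfam : CodeFP (pairE (rawE (rawE natE)) (rawE natE)) (rawE (rawE natE)) (fun p => p.1) := fst _ (rawE natE)
  have hl : CodeFP (pairE (rawE (rawE natE)) (rawE natE)) (rawE natE) (fun p => p.2) := snd (rawE (rawE natE)) _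
  have hw := (rawHeadD natE (d := 0) rfl).comp ((rawHeadD (rawE natE) (d := []) rfl).comp hfam)
  have hd := deserialize'_code.comp hl
  have hout := hd.snd'.snd'.fst'
  have hgs := hd.snd'.snd'.snd'
  have hok := (hd.fst'.and (natEq.comp (hd.snd'.fst'.pair hw))).and
    ((validC_code dW).comp (hw.pair (((wSize_code e).comp hw).pair (hout.pair hgs))))
  have hcode := circuitC'_code.comp (hw.pair ((famOf_code.comp hfam).pair (hout.pair ((map₀ (canonC_code m)).comp hgs))))
  have h := hok.pair (hok.ite hcode (cst (pairE (rawE (rawE natE)) (rawE natE)) (rawE natE) ([] : List ℕ)))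
  exact h.congr fun p => by simp only [gCore]

/-! ### The untyped ends: decoding any string, flag dispatch, output shaping -/

open Brick

/-- **The total decoder of a guessed string into naturals**: the items of its second pair component,
read by value. On the code of a list of naturals it returns the list (`decStr_listE`). [folklore] -/
def decStr (r : List Bool) : List ℕ := (decNil (sndF r)).map bitsToNat

/-- `decStr` inverts `listE natE`. [folklore] -/
theorem decStr_listE (l : List ℕ) : decStr (listE natE l) = l := by
  rw [decStr, show listE natE l = boolPair (unE l.length) (rawE natE l) from rfl, sndF_boolPair, decNil_rawE,
    List.map_map]
  conv_rhs => rw [← List.map_id l]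
  exact List.map_congr_left fun n _ => bitsToNat_natE n

/-- The decoded list is no longer than the string. [folklore] -/
theorem length_decStr_le (r : List Bool) : (decStr r).length ≤ r.length := by
  rw [decStr, List.length_map]
  have h1 := length_decNil_le (sndF r)
  have h2 := length_fstF_sndF_le r
  omega

/-- Appending along a list is a `flatMap`. [folklore] -/
theorem foldl_append_flatMap {α : Type} (f : α → List Bool) (l : List α) (acc : List Bool) :
    l.foldl (fun acc a => acc ++ f a) acc = acc ++ l.flatMap f := by
  induction l generalizing acc with
  | nil => simp
  | cons a l ih => rw [List.foldl_cons, ih]; simp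

/-- **`decStr` is computed on strings by an `FP` function** (a `Brick.foldFn` re-encoding every
item canonically). [cite: AroraBarak2009, §1.3 (bounded loops)] -/
theorem decStr_code : CodeFP strE (rawE natE) decStr := by
  set step : List Bool → List Bool := fun v => sndPow 1 v ++ fanoutFn (norm ∘ nthF 1) (fun _ => []) v with hstep
  have hFP : step ∈ FP :=
    append_mem_FP (sndPow_mem_FP 1) (fanoutFn_mem_FP (comp_mem_FP norm_mem_FP (nthF_mem_FP 1)) (const_mem_FP []))
  have hgrowth : FoldGrowth 2 step := fun v => by
    have h1 : sndPow 1 v = sndF (sndF v) := rfl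
    have h2 : nthF 1 v = fstF (sndF v) := rfl
    rw [hstep]
    simp only [List.length_append, fanoutFn_apply, length_boolPair, Function.comp_apply, List.length_nil, h1, h2]
    have := length_norm_le (fstF (sndF v))
    omega
  refine ⟨foldFn step (fun _ => []), foldFn_mem_FP hFP (const_mem_FP []) hgrowth, fun r => ?_⟩
  rw [foldFn_apply]
  change List.foldl (fun acc a => step (boolPair r (boolPair a acc))) [] (decNil (sndF r)) = rawE natE (decStr r)
  have hs : ∀ acc a : List Bool, step (boolPair r (boolPair a acc)) = acc ++ boolPair (norm a) [] := by
    intro acc a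
    rw [hstep]
    simp [sndPow, nthF]
  rw [show (fun (acc a : List Bool) => step (boolPair r (boolPair a acc))) = fun acc a => acc ++ boolPair (norm a) [] from
    funext fun acc => funext fun a => hs acc a, foldl_append_flatMap, List.nil_append]
  show (decNil (sndF r)).flatMap (fun a => boolPair (norm a) []) = encList ((decStr r).map natE)
  rw [Com.encList_eq_flatMap, decStr, List.map_map, List.flatMap_map]
  refine List.flatMap_congr fun a _ => ?_
  simp [boolPair, norm_eq_encodeNat]

/-- **Stage `F` as a typed map**: codes of the clause circuits and the raw witness string in, flag
and headed code out. [folklore] -/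
def gFull (m dW e : ℕ) (p : List (List ℕ) × List Bool) : Bool × List ℕ := gCore m dW e (p.1, decStr p.2)

/-- `gFull` on codes (input `⟨listE (listE natE) fam, r⟩`, output `⟨[ok], listE natE code⟩`). [folklore] -/
theorem gFull_code (m dW e : ℕ) :
    CodeFP (pairE (listE (listE natE)) strE) (pairE bitE (listE natE)) (gFull m dW e) := by
  have hfam := ((map₀ (rawOfList natE)).comp (rawOfList (listE natE))).comp (fst (listE (listE natE)) strE)
  have hr := decStr_code.comp (snd (listE (listE natE)) strE)
  have hcore := (gCore_code m dW e).comp (hfam.pair hr)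
  have h := hcore.fst'.pair ((listOfRaw natE).comp hcore.snd')
  exact h.congr fun p => by simp [gFull, List.map_id]

/-- The output word of stage `F`: `1 code` when the flag is raised, `00` otherwise. [folklore] -/
def outWord (v : Bool × List ℕ) : List Bool := if v.1 then true :: listE natE v.2 else [false, false]

/-- **The output shaping is an `FP` string function** on the codes `⟨[ok], code⟩`. [folklore] -/
theorem outWord_code : CodeFP (pairE bitE (listE natE)) strE outWord := by
  refine ⟨iteFn (ltFn ∘ fanoutFn (fun _ => []) fstF) (List.cons true ∘ sndF) (fun _ => [false, false]),
    iteFn_mem_FP (comp_mem_FP ltFn_mem_FP (fanoutFn_mem_FP (const_mem_FP []) fstF_mem_FP))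
      (comp_mem_FP (cons_mem_FP true) sndF_mem_FP) (const_mem_FP _), fun v => ?_⟩
  obtain ⟨b, l⟩ := v
  have hc : (ltFn ∘ fanoutFn (fun _ => []) fstF) (pairE bitE (listE natE) (b, l)) = [b] := by
    cases b <;> simp [bitE, bitsToNat]
  rw [iteFn_apply hc]
  cases b <;> simp [outWord, bitE]

/-- **Stage `F` as a string function**: dispatch on the leading bit, then the typed map, then the
output word. [folklore] -/
theorem exists_stageF (m dW e : ℕ) : ∃ F : List Bool → List Bool, F ∈ FP ∧ F [false, false] = [false, false] ∧
    ∀ (fam : List (List ℕ)) (r : List Bool),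
      F (true :: boolPair (listE (listE natE) fam) r) = outWord (gFull m dW e (fam, r)) := by
  obtain ⟨G, hG, hGs⟩ := gFull_code m dW e
  obtain ⟨P, hP, hPs⟩ := outWord_code
  obtain ⟨D, hD, hDs⟩ := (strDrop.comp ((cst strE unE 1).pair (CodeFP.id strE)))
  refine ⟨iteFn (ltFn ∘ fanoutFn (fun _ => []) take1Fn) (P ∘ G ∘ D) (fun _ => [false, false]),
    iteFn_mem_FP (comp_mem_FP ltFn_mem_FP (fanoutFn_mem_FP (const_mem_FP []) take1Fn_mem_FP))
      (comp_mem_FP hP (comp_mem_FP hG hD)) (const_mem_FP _), ?_, fun fam r => ?_⟩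
  · have hc : (ltFn ∘ fanoutFn (fun _ => []) take1Fn) [false, false] = [false] := by
      simp [take1Fn, bitsToNat]
    rw [iteFn_apply hc]
    simp
  · have hc : (ltFn ∘ fanoutFn (fun _ => []) take1Fn) (true :: boolPair (listE (listE natE) fam) r) = [true] := by
      simp [take1Fn, bitsToNat]
    rw [iteFn_apply hc, if_pos rfl, Function.comp_apply, Function.comp_apply]
    have hD1 : D (true :: boolPair (listE (listE natE) fam) r) = boolPair (listE (listE natE) fam) r := by
      have := hDs (true :: boolPair (listE (listE natE) fam) r)
      simpa using this
    rw [hD1, show boolPair (listE (listE natE) fam) r = pairE (listE (listE natE)) strE (fam, r) from rfl, hGs, hPs]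
    rfl

/-! ### The specification of stage `F` -/

/-- The tree's encodings are the typed codes. [folklore] -/
theorem encode_listNat_eq_listE : (encodingListNatBool.encode : List ℕ → List Bool) = listE natE := by
  rw [show (encodingListNatBool : Encoding (List ℕ) Bool) = encodingNatBool.listBool from rfl, listE_eq, natE_eq]

/-- `encodeAccCircuit m = listE natE ∘ circuitCodeList m`. [folklore] -/
theorem encodeAccCircuit_eq_listE (m : ℕ) {n : ℕ} (C : Circuit (Fin n)) :
    encodeAccCircuit m C = listE natE (circuitCodeList m C) := by
  rw [encodeAccCircuit, encode_listNat_eq_listE]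

/-- `encodeAccCircuitList m = listE (listE natE) ∘ map (circuitCodeList m)`. [folklore] -/
theorem encodeAccCircuitList_eq_listE (m : ℕ) {n : ℕ} (Cs : List (Circuit (Fin n))) :
    encodeAccCircuitList m Cs = listE (listE natE) (Cs.map (circuitCodeList m)) := by
  rw [encodeAccCircuitList, listE_eq, encode_listNat_eq_listE]

/-- The printed codes of the clause circuits, in print order. [folklore] -/
def famList (m : ℕ) {w : ℕ} (G : ClauseCoord w → Circuit (Fin w)) : List (List ℕ) :=
  ((clauseCoordList w).map G).map (circuitCodeList m)

/-- The first printed code starts with the number of inputs. [folklore] -/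
theorem headD_famList (m : ℕ) {w : ℕ} (G : ClauseCoord w → Circuit (Fin w)) : ((famList m G).headD []).headD 0 = w := by
  have hne : clauseCoordList w ≠ [] := fun h => by
    have := length_clauseCoordList w; rw [h] at this; simp at this
  obtain ⟨κ, l, hκ⟩ := List.exists_cons_of_ne_nil hne
  simp [famList, hκ, circuitCodeList]

/-- The blocks read off the printed codes are the coded family `famC`. [folklore] -/
theorem famOf_famList (m : ℕ) {w : ℕ} (G : ClauseCoord w → Circuit (Fin w)) : famOf (famList m G) = famC m G := by
  simp only [famOf, famList, famC, List.map_map]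
  refine List.map_congr_left fun κ _ => ?_
  simp only [Function.comp_apply]
  have h := deserialize'_of_some ((circuitCodeList_eq_serialize m (G κ)).symm ▸ deserialize_serialize w (wireC (G κ).output)
    ((G κ).gates.map (gateC m)))
  rw [h]

/-- The fan-in of the realised circuit is bounded by the arities of its gate codes. [folklore] -/
theorem maxFanIn_realize_le {m n dW sz B : ℕ} {out : WireC} {gs : List GateC} (hv : validC n dW sz out gs = true)
    (hB : ∀ g ∈ gs, g.2.length ≤ B) : (realize m n dW sz out gs).maxFanIn ≤ B := by
  refine Circuit.maxFanIn_le_of_forall _ fun g hg => ?_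
  rw [realize_gates hv] at hg
  obtain ⟨gc, hgc, rfl⟩ := List.mem_map.1 hg
  exact hB gc hgc

/-- **Stage `F` of the machine `B` is polynomial time**: for all parameters there is an `FP` string
function with `SatInstanceFn.Spec` (Williams 2014, p. 13: "`B` … constructs an `ACC` CIRCUIT SAT
instance `D`", here in polynomial time from the printout of `A` and the guessed `W`).
[cite: Williams2014, proof of Thm. 3.2 (p. 13)] -/
theorem exists_satInstanceFn (m dW e : ℕ) : ∃ F : List Bool → List Bool, F ∈ FP ∧ SatInstanceFn.Spec m dW e F := by
  obtain ⟨F, hF, hF0, hF1⟩ := exists_stageF m dW e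
  refine ⟨F, hF, hF0, fun w G hG => ?_⟩
  have hout : encodeAccCircuitList m ((clauseCoordList w).map G) = listE (listE natE) (famList m G) := by
    rw [encodeAccCircuitList_eq_listE]; rfl
  have hw := headD_famList m G
  have hfam := famOf_famList m G
  have hlen := length_TC_famC m G
  constructor
  · -- soundness
    intro r
    rw [hout, hF1]
    simp only [outWord, gFull, gCore, hw, hfam]
    set d := deserialize' (decStr r) with hd
    by_cases hok : (d.1 && decide (d.2.1 = w) && validC w dW (wSize e w) d.2.2.1 d.2.2.2) = true
    · right
      simp only [Bool.and_eq_true, decide_eq_true_eq] at hok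
      obtain ⟨⟨hflag, hn⟩, hv⟩ := hok
      have hdes := deserialize_of_flag hflag
      refine ⟨realize m w dW (wSize e w) d.2.2.1 d.2.2.2, realize_isOver hv, acDepth_realize_le hv, ?_, ?_, ?_⟩
      · rw [size_realize hv]; exact (validC_parts hv).2.2.1
      · refine maxFanIn_realize_le hv fun g hg => ?_
        have h1 := arity_le_of_deserialize (n := d.2.1) (out := d.2.2.1) (gs := d.2.2.2) hdes g hg
        have h2 := length_decStr_le r
        omega
      · rw [if_pos (by simp [hflag, hn, hv]), if_pos (by simp [hflag, hn, hv]), circuitC'_eq _ _ hlen,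
          circuitC_realize m G hv, encodeAccCircuit_eq_listE]
    · left
      have hok' : (d.1 && decide (d.2.1 = w) && validC w dW (wSize e w) d.2.2.1 d.2.2.2) = false := by
        simpa using hok
      rw [hok']
      simp
  · -- completeness
    intro W hWB hWd hWs
    obtain ⟨hdes, hv, hcan, hcode⟩ := circuitC_of_circuit m G W hWB hWd hWs
    rw [hout, hF1, encodeAccCircuit_eq_listE, encodeAccCircuit_eq_listE]
    simp only [outWord, gFull, gCore, hw, hfam, decStr_listE, deserialize'_of_some hdes, hv, decide_true,
      Bool.and_self, if_true, hcan, circuitC'_eq _ _ hlen, hcode]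

end SatCode

/-! ### The machine `B`: discharge of `Williams2014_thm_3_2_machineB` -/

/-- Stage 1 of `B` exists (`Williams2014MachineBPlumbing.lean`; the `if` of
`exists_reassocMachine` is `guardLen`). [folklore] -/
theorem exists_reassocMachine' : ∃ (P : Turing.TM2ComputableAux Bool Bool) (C : ℕ), ReassocMachine P C := by
  obtain ⟨P, hP⟩ := MachineB.exists_reassocMachine
  exact ⟨P, 61, fun x u z => hP x u z⟩

/-- Stage 3 of `B` exists (`Williams2014MachineBPlumbing.lean`, by cases on the flag word). [folklore] -/
theorem exists_okDispatchMachine' : ∃ (P : Turing.TM2ComputableAux Bool Bool) (C : ℕ), OkDispatchMachine P C := by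
  obtain ⟨P, hP1, hP2⟩ := MachineB.exists_okDispatchMachine
  refine ⟨P, 31, fun v r => ?_⟩
  rcases v with _ | ⟨b, out⟩
  · exact hP2 [] r (fun out h => by simp at h)
  · cases b
    · exact hP2 (false :: out) r (fun out' h => by simp at h)
    · exact hP1 out r

/-- **Williams 2014, proof of Thm. 3.2: the machine `B`** — the named fact
`Williams2014_thm_3_2_machineB` (`Williams2014Lemma31.lean`) HOLDS: the assembly
`Williams2014_thm_3_2_machineB_of_stages` (`Williams2014MachineB.lean`) fed with the linear-time
stages 1 and 3 (`Williams2014MachineBPlumbing.lean`) and the polynomial-time stage `F`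
(`SatCode.exists_satInstanceFn`). [cite: Williams2014, proof of Thm. 3.2 (pp. 12–13)] -/
theorem Williams2014_thm_3_2_machineB_holds : Williams2014_thm_3_2_machineB :=
  Williams2014_thm_3_2_machineB_of_stages exists_reassocMachine' exists_okDispatchMachine'
    SatCode.exists_satInstanceFn

/-- Hence Williams' Theorem 3.2 (polynomial rerun) from Lemma 3.1 alone. [cite: Williams2014, Thm. 3.2] -/
theorem Williams2014_thm_3_2_of_lemma_3_1 (hA : Williams2014_lemma_3_1) : Williams2014_thm_3_2 :=
  Williams2014_thm_3_2_of_parts hA Williams2014_thm_3_2_machineB_holds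

/-- And the `ACC` lower-bound transfer (Williams 2014, Thm. 1.3 for `ACC`) from Fact 3.1, IKW's
Thm. 5.2, Lemma 3.1 and the (proved) nondeterministic time hierarchy.
[cite: Williams2014, Thm. 1.3] -/
theorem Williams2014_lowerBound_of_accSat_of_three (h31 : Williams2014_fact_3_1) (h52 : Williams2014_thm_5_2)
    (hA : Williams2014_lemma_3_1) : Williams2014_lowerBound_of_accSat :=
  Williams2014_lowerBound_of_accSat_of_lemma_3_1 h31 h52 hA Williams2014_thm_3_2_machineB_holds
    Diag.ntime_hierarchy_holds

end Literature.Computability.Complexity
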